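import Literature.MathematicalPhysics.QuantumFieldTheory.Balaban1983to89.StrongCouplingKPWindow
import Literature.MathematicalPhysics.QuantumFieldTheory.LatticeGaugeDobrushin
import Literature.Probability.LatticeModels.LatticeAnimals
import Mathlib.Algebra.BigOperators.Ring.Finset
import HarnessLib

/-!
# Closed link-connected plaquette complexes of `ℤ⁴`: `closedCount 4 n ≤ 0.7·14.95ⁿ` — the tail obligation `TailBoundT2` HOLDS (re-homed proofs)

**The tail obligation `TailBoundT2` of `Literature/MathematicalPhysics/QuantumFieldTheory/Balaban1983to89/StrongCouplingKPWindow.lean` HOLDS**: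
`closedCount 4 n ≤ (7/10)·(299/20)^n` for every `n ≥ 2` — the number of CLOSED (every link in `≥ 2` plaquettes), LINK-CONNECTED sets of `n`
plaquettes of `ℤ⁴` through the fixed root link grows at most like `0.7·14.95ⁿ`.  PURE COMBINATORICS of `ℤ⁴` (no group, no coupling, no volume);
the statement was typed in the tree as a NAMED OBLIGATION («analysis grade, NOT proved in the tree — a named `Prop` a prover may discharge») used
as an explicit hypothesis by the strong-coupling Kotecký–Preiss rows, and its proof is the tree's OWN (a DFS/Kraft-inequality encoding; not a
published theorem — the context is Balaban's strong-coupling cluster expansion [MontvayMunster1994]).  PROOF (kernel-checked; until now Summits-side only,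
`Summits/QuantumFields/YangMills/Theorems/Instrument/ClosedComplexTailBound.lean`): explore the complex link by link from the root (states,
selection of an undecided link, blocks of new-born plaquettes; `ClosedComplexExploration`), encode the run by DFS codes with a Kraft inequality
(`ClosedComplexCountDFSBound`, `AdmissibleLinkComplexCount`), and bound the weight of every closed connected complex from below along its run
(`x^n y^{3n}`: block indicators are `1` by closedness, new-born counts telescope to `n`, present counts `≤ 3n` by the potential `Φ`), so that
`count · x^n y^{3n} ≤ 7/10` with the numerical Kraft sum of part 1; the general form `admClosedCount_le_T2` (closed on admissible links, connected
through admissible links, any admissibility predicate) specialises to `closedCount 4 n` at `Adm = ⊤`.  RE-HOMED into `Literature/` by the Hodge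
foundations lane (`lit-hodgefound`, seat p20, generation 38): verbatim DECLARATION-LEVEL ports (the declarations needed, in dependency order) of
`Summits/QuantumFields/YangMills/Theorems/Instrument/{ClosedComplexCountBound (3), ClosedComplexExploration (30), ClosedComplexCountDFSBound (11),
AdmissibleLinkComplexCount (4), ClosedComplexTailBound (28)}.lean`, namespace `Summit.QuantumFields.YangMills.Theorems.Instrument` re-rooted as
`Literature.MathematicalPhysics.QuantumFieldTheory.Balaban1983to89.ClosedComplexes`, followed by the EXACT-name discharge
`Literature.MathematicalPhysics.QuantumFieldTheory.Balaban1983to89.StrongCouplingKPWindow.TailBoundT2_holds`.  The exploration machine's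
definitions come with their bodies (`nbr`, `atLink`, the structures `State` / `Inv`, `und`, `sel`, `step`, `xK`, `yK`, `bw`, `wt`, `init`, `W`,
`ValidFrom`, `stackAfter`, `pushes`, `decode`, `codes`, `IsAdmConnected`, `dfsFamilyAt`, `AdmClosed`, `Φ`, `U`, `μ`, `validFamily` — finite
combinatorial gadgets); no new named fact (D-0026), no Summits import; built on the tree's Literature layer (`StrongCouplingKPWindow`,
`LatticeGaugeDobrushin`, `Probability/LatticeModels/LatticeAnimals`) and Mathlib.  The Summits originals stay in place (transitional duplication).
WHAT THIS IS NOT: not a statement about any gauge theory, not a radius, not a clustering rate, not summit-bearing; it removes one explicit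
hypothesis (`hT : TailBoundT2`) from the conditional strong-coupling rows, nothing more.
-/

noncomputable section

/-!
## Part 1 — port of `Summits/QuantumFields/YangMills/Theorems/Instrument/ClosedComplexCountBound.lean` (8 declarations kept)

# Instrument cell `ym-instrument`, crew (b): the KERNEL lattice-animal bound for the polymer counts of the tree's Kotecký–Preiss window —
# `closedCount 4 n ≤ 6 · 441^(n−1)` for every `n` (and `closedCount 4 0 = 0`), from `LatticeAnimals` BY NAME

QUESTIONS.md rows: Q-B1 (REGISTERED 2026-08-26T13:54:11Z; readings A-0826-8, A-0826-16); certs/b/FORMAT.md v1.3 §3b (the `counts`/`tail` columns of a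
`kp` object); cell `run/shared/lean/pub/ym-instrument/`, HUMAN RULING D-0084 (2), director-ym R138.  HONEST FRAMING (page 1, binding).  WHAT IS CERTIFIED
HERE AND AT WHICH `(G, D, L, β)`: PURE LATTICE COMBINATORICS of `ℤ⁴` (no group, no coupling, no measure): the number `closedCount 4 n` of closed
link-connected `n`-plaquette complexes of `ℤ⁴` through the fixed root link — the coefficient sequence of the tree's computable criterion
`Balaban1983to89.StrongCouplingKPWindow.KPCriterionSU2` — is bounded by `6 · 441^(n−1)` for EVERY `n`, by instantiating the tree's kernel lemma
`Literature.Probability.LatticeModels.LatticeAnimals` — the general kernel count is `card_connectedFamily_le` (cited by the KPWindow docstring); we use its two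
ingredients `exists_lazyWalk_cover`, `card_lazyWalks_le` (a connected `n`-set is traced by a closed lazy walk of length `2(n−1)`; at most `(Δ+1)^{2(n−1)}` such walks) — on the plaquettes of `ℤ⁴` with the share-a-link adjacency: `Δ = 20` (a plaquette has `4` links —
`card_plaquetteEdges_le` —, a link of `ℤ⁴` lies in `2(d−1) = 6` plaquettes — `card_plaquettesTouching_singleton_le`, both tree lemmas of `LatticeGaugeDobrushin`),
`6` plaquettes through the root link.  This is the «kernel lemma `6·441^{n−1}`» named in the docstring of the tree's `TailBoundT2` (J-SC1 certificate, pub-balaban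
`FRONT-SC.md` §3: window `0.00188` at census depth `10`) — never typed before; closedness is not even used.  WHAT THIS IS FOR: it is the ONLY tail bound on
`closedCount` that is a tree THEOREM (the sharper `TailBoundT2 = 0.7·14.95ⁿ` and sc-eng-2's Lemma C `≤ C(10n+1, n)` are paper-level, Lean OPEN), hence the only
route today to a HYPOTHESIS-FREE instance of `KPCriterionSU2` (companion file `KPCriterionSU2Unconditional`: window `β_W ≤ 33/20000 = 0.00165`, a factor `28`
inside the certified-conditional `r★ = 0.047` and a factor `170` inside the hypothesis-free SC-c door `2/7`; reading rule A-0826-16: a number inside `[0, 0.328)`,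
never a path to the door).  NOT a clustering statement, NOT a mass gap, NOT summit-bearing.  Grade (T): every statement below is a hypothesis-free kernel theorem.

(Verbatim declaration-level port — the declarations listed in the Part header count — of the Summits-side module of the YangMills
instrument cell; cell / crew / ruling bookkeeping in the text above is historical.)
-/

section Part1

open _root_.Finset
open Literature.MathematicalPhysics.QuantumLattice (ZdEdge ZdPlaquette plaquetteEdges plaquettesTouching)
open Literature.MathematicalPhysics.QuantumFieldTheory (mem_plaquettesTouching_singleton card_plaquettesTouching_singleton_le card_plaquetteEdges_le)
open Literature.MathematicalPhysics.QuantumFieldTheory.Balaban1983to89.StrongCouplingKPWindow (links IsClosedComplex IsLinkConnected rootLink closedCount)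
open Literature.Probability.LatticeModels (lazyWalks card_lazyWalks_le exists_lazyWalk_cover)

namespace Literature.MathematicalPhysics.QuantumFieldTheory.Balaban1983to89.ClosedComplexes.ClosedComplexCountBound

variable {d : ℕ}

/-! ## §1 The share-a-link adjacency of plaquettes: at most `4(2(d−1) − 1)` neighbours (`20` for `d = 4`) -/

/-- The neighbour list of a plaquette: the other plaquettes through each of its four links (the tree's `plaquettesTouching {e}`). [cite: MontvayMunster1994, strong-coupling cluster expansion: counting closed link-connected plaquette complexes of ℤ⁴ (the count bound itself is the tree's own, OURS)] -/
def nbr (p : ZdPlaquette d) : Finset (ZdPlaquette d) := (plaquetteEdges p).biUnion fun e => (plaquettesTouching {e}).erase p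

/-- `#nbr p ≤ 4 · (2(d−1) − 1)` (tree lemmas `card_plaquetteEdges_le`, `card_plaquettesTouching_singleton_le`). [cite: MontvayMunster1994, strong-coupling cluster expansion: counting closed link-connected plaquette complexes of ℤ⁴ (the count bound itself is the tree's own, OURS)] -/
theorem card_nbr_le (p : ZdPlaquette d) : (nbr p).card ≤ 4 * (2 * (d - 1) - 1) := by
  unfold nbr
  refine (card_biUnion_le_card_mul _ _ (2 * (d - 1) - 1) fun e he => ?_).trans
    (Nat.mul_le_mul_right _ (card_plaquetteEdges_le p))
  rw [card_erase_of_mem (mem_plaquettesTouching_singleton.2 he)]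
  exact Nat.sub_le_sub_right (card_plaquettesTouching_singleton_le e) 1

/-- For `d = 4`: at most `20` neighbours. [cite: MontvayMunster1994, strong-coupling cluster expansion: counting closed link-connected plaquette complexes of ℤ⁴ (the count bound itself is the tree's own, OURS)] -/
theorem card_nbr_le_twenty (p : ZdPlaquette 4) : (nbr p).card ≤ 20 := (card_nbr_le p).trans (by norm_num)

/-- The adjacency «distinct plaquettes sharing a link» (written inline as `p ≠ q ∧ ¬ Disjoint (plaquetteEdges p) (plaquetteEdges q)`)
is symmetric. [cite: MontvayMunster1994, strong-coupling cluster expansion: counting closed link-connected plaquette complexes of ℤ⁴ (the count bound itself is the tree's own, OURS)] -/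
theorem adj_symm {p q : ZdPlaquette d} (h : p ≠ q ∧ ¬ Disjoint (plaquetteEdges p) (plaquetteEdges q)) :
    q ≠ p ∧ ¬ Disjoint (plaquetteEdges q) (plaquetteEdges p) :=
  ⟨h.1.symm, fun hd => h.2 hd.symm⟩

/-- An adjacent plaquette is listed in `nbr`. [cite: MontvayMunster1994, strong-coupling cluster expansion: counting closed link-connected plaquette complexes of ℤ⁴ (the count bound itself is the tree's own, OURS)] -/
theorem mem_nbr_of_adj {p q : ZdPlaquette d} (h : p ≠ q ∧ ¬ Disjoint (plaquetteEdges p) (plaquetteEdges q)) : q ∈ nbr p := by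
  obtain ⟨e, hep, heq⟩ := not_disjoint_iff.1 h.2
  unfold nbr
  exact mem_biUnion.2 ⟨e, hep, mem_erase.2 ⟨h.1.symm, mem_plaquettesTouching_singleton.2 heq⟩⟩

/-- A link-connected complex is connected inside itself, for the adjacency «distinct and sharing a link», from any of its plaquettes (the idle
steps `a = b` allowed by the tree's relation are dropped). [cite: MontvayMunster1994, strong-coupling cluster expansion: counting closed link-connected plaquette complexes of ℤ⁴ (the count bound itself is the tree's own, OURS)] -/
theorem reflTransGen_adj_of_isLinkConnected {X : Finset (ZdPlaquette d)} (hX : IsLinkConnected X) {p : ZdPlaquette d}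
    (hp : p ∈ X) : ∀ w ∈ X, Relation.ReflTransGen
      (fun x y => (x ≠ y ∧ ¬ Disjoint (plaquetteEdges x) (plaquetteEdges y)) ∧ x ∈ X ∧ y ∈ X) p w := by
  intro w hw
  have h := hX p hp w hw
  clear hw
  induction h with
  | refl => exact Relation.ReflTransGen.refl
  | @tail b c _ hbc ih =>
    obtain ⟨hb, hc, hnd⟩ := hbc
    by_cases hbc' : b = c
    · exact hbc' ▸ ih
    · exact ih.tail ⟨⟨hbc', hnd⟩, hb, hc⟩

/-! ## §2 ★ The count: `closedCount 4 n ≤ 6 · 441^(n−1)` -/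

/-- The finite family that contains every rooted link-connected `n`-complex: vertex sets of closed lazy walks of length `2(n−1)` started at one of
the (at most six) plaquettes through the root link. [cite: MontvayMunster1994, strong-coupling cluster expansion: counting closed link-connected plaquette complexes of ℤ⁴ (the count bound itself is the tree's own, OURS)] -/
def coverFamily (n : ℕ) : Finset (Finset (ZdPlaquette 4)) :=
  (plaquettesTouching {rootLink 4}).biUnion fun p => (lazyWalks nbr p (2 * (n - 1))).image List.toFinset

/-- Every link-connected `n`-complex through the root link belongs to `coverFamily n` (`LatticeAnimals.exists_lazyWalk_cover`). [cite: MontvayMunster1994, strong-coupling cluster expansion: counting closed link-connected plaquette complexes of ℤ⁴ (the count bound itself is the tree's own, OURS)] -/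
theorem mem_coverFamily {n : ℕ} {X : Finset (ZdPlaquette 4)} (hcard : X.card = n) (hroot : rootLink 4 ∈ links X)
    (hconn : IsLinkConnected X) : X ∈ coverFamily n := by
  unfold links at hroot
  obtain ⟨p, hpX, hpe⟩ := mem_biUnion.1 hroot
  have hS := reflTransGen_adj_of_isLinkConnected hconn hpX
  obtain ⟨l, hl, hlX, -⟩ := exists_lazyWalk_cover
    (R := fun x y : ZdPlaquette 4 => x ≠ y ∧ ¬ Disjoint (plaquetteEdges x) (plaquetteEdges y)) (nbr := nbr)
    (fun _ _ h => adj_symm h) (fun _ _ h => mem_nbr_of_adj h) hpX hS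
  rw [hcard] at hl
  unfold coverFamily
  exact mem_biUnion.2 ⟨p, mem_plaquettesTouching_singleton.2 hpe, mem_image.2 ⟨l, hl, hlX⟩⟩

end Literature.MathematicalPhysics.QuantumFieldTheory.Balaban1983to89.ClosedComplexes.ClosedComplexCountBound

end Part1

/-!
## Part 2 — port of `Summits/QuantumFields/YangMills/Theorems/Instrument/ClosedComplexExploration.lean` (30 declarations kept)

# Instrument cell `ym-instrument`, crew (b): the link-by-link EXPLORATION of a plaquette complex of `ℤ⁴` through ADMISSIBLE links and its KRAFT
# INEQUALITY (part 1 of the discharge of the tree's tail obligation `TailBoundT2` and of its (G1) twin T2′; part 2 = `ClosedComplexTailBound`)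

QUESTIONS.md: Q-B1 (A-0826-8 reading (i) REACH; the certs/b radius∕rate rows of record carry `conditional_on ["T2"]` = the tree's NAMED OBLIGATION
`Balaban1983to89.StrongCouplingKPWindow.TailBoundT2`, `closedCount 4 n ≤ (7/10)·(299/20)^n`).  Cell `run/shared/lean/pub/ym-instrument/`, HUMAN RULING D-0084 (2),
director-ym R138.  HONEST FRAMING (page 1, binding).  WHAT IS CERTIFIED HERE AND AT WHICH `(G, D, L, β)`: PURE COMBINATORICS of `ℤ⁴` (no group, no
coupling, no volume) — the machine of the paper proof `pub-balaban/ir/data/FRONT-SC-taillemma.txt` steps (1), (4), GENERIC in a link predicate `Adm`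
(«admissible» links: ALL links for `TailBoundT2`; the FREE links of the axial-2 comb gauge for S2-SPEC's (G1) class = sc-eng-2's T2′, 2026-08-27T00:09:38Z):
the exploration of a target plaquette set `X` admissible link by admissible link (state = plaquettes born so far `Y` + links decided `D`; a block decides one
undecided ADMISSIBLE link of `Y` (`und`, `sel`, `step`): the plaquettes of `X` through it not yet born are born), the block weight `bw c m = [2 ≤ c + m]·x^m·y^c` (`c` plaquettes already present at the decided link, `m` new-born;
`x = 19/100`, `y = (1+x)^{−2}` — the paper's linear programme collapsed to the pointwise `F_c(x) ≤ (1+x)^{2c}`), the run weight `wt` (product of block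
weights, `1` at a terminal state whose born set is the target), and ★ the KRAFT INEQUALITY `kraft`: from any state with any fuel the run weights of any
family of distinct targets sum to `≤ 1` — because a link of `ℤ⁴` lies in `≤ 6` plaquettes (`LatticeGaugeDobrushin.card_plaquettesTouching_singleton_le`), so
the block weights at a state sum to `≤ 1` (`kraft_step`; binding cases `(c, 6 − c) = (1, 5)`: `0.979`, `(2, 4)`: equality) — and `≤ 7/10` with the root
block (`kraft_root_sum`: `(1.19)^6 − 1 − 6·0.19 = 0.69976…`).  Part 2 shows that the run of an `Adm`-CONNECTED `n`-complex CLOSED ON ITS ADMISSIBLE LINKS through an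
admissible root link has weight `≥ x^n y^{3n}` and concludes the count `≤ (7/10)·(299/20)^n` for every `Adm` — `TailBoundT2` at `Adm = ⊤`.  NOT a statement about any gauge theory, NOT a radius, NOT summit-bearing.  Grade (T).

(Verbatim declaration-level port — the declarations listed in the Part header count — of the Summits-side module of the YangMills
instrument cell; cell / crew / ruling bookkeeping in the text above is historical.)
-/

section Part2

open _root_.Finset
open Literature.MathematicalPhysics.QuantumLattice (ZdEdge ZdPlaquette plaquetteEdges plaquettesTouching)
open Literature.MathematicalPhysics.QuantumFieldTheory (mem_plaquettesTouching_singleton card_plaquettesTouching_singleton_le card_plaquetteEdges_le)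
open Literature.MathematicalPhysics.QuantumFieldTheory.Balaban1983to89.StrongCouplingKPWindow (links IsLinkConnected IsClosedComplex rootLink closedCount TailBoundT2)
open Literature.MathematicalPhysics.QuantumFieldTheory.Balaban1983to89.ClosedComplexes.ClosedComplexCountBound (coverFamily mem_coverFamily)

namespace Literature.MathematicalPhysics.QuantumFieldTheory.Balaban1983to89.ClosedComplexes.ClosedComplexExploration

/-! ## §1 The exploration process -/

/-- The plaquettes of `Y` through the link `l`. [cite: MontvayMunster1994, strong-coupling cluster expansion: counting closed link-connected plaquette complexes of ℤ⁴ (the count bound itself is the tree's own, OURS)] -/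
abbrev atLink (Y : Finset (ZdPlaquette 4)) (l : ZdEdge 4) : Finset (ZdPlaquette 4) := Y.filter fun p => l ∈ plaquetteEdges p

/-- A state of the exploration: the plaquettes born so far and the links already decided. [cite: MontvayMunster1994, strong-coupling cluster expansion: counting closed link-connected plaquette complexes of ℤ⁴ (the count bound itself is the tree's own, OURS)] -/
structure State where
  /-- plaquettes born so far -/
  Y : Finset (ZdPlaquette 4)
  /-- links already decided -/
  D : Finset (ZdEdge 4)

variable (Adm : ZdEdge 4 → Prop) [DecidablePred Adm]

/-- The undecided links of a state: ADMISSIBLE links of the born plaquettes not yet decided. [cite: MontvayMunster1994, strong-coupling cluster expansion: counting closed link-connected plaquette complexes of ℤ⁴ (the count bound itself is the tree's own, OURS)] -/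
def und (s : State) : Finset (ZdEdge 4) := (links s.Y).filter Adm \ s.D

/-- A selection rule: some element of a nonempty link set (which one is immaterial). [cite: MontvayMunster1994, strong-coupling cluster expansion: counting closed link-connected plaquette complexes of ℤ⁴ (the count bound itself is the tree's own, OURS)] -/
def sel (U : Finset (ZdEdge 4)) : ZdEdge 4 := if h : U.Nonempty then h.choose else rootLink 4

/-- The selected link belongs to the set. [cite: MontvayMunster1994, strong-coupling cluster expansion: counting closed link-connected plaquette complexes of ℤ⁴ (the count bound itself is the tree's own, OURS)] -/
theorem sel_mem {U : Finset (ZdEdge 4)} (h : U.Nonempty) : sel U ∈ U := by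
  unfold sel; rw [dif_pos h]; exact h.choose_spec

/-- One block of the exploration of the target `X`: decide the selected undecided link, the plaquettes of `X` through it are born. [cite: MontvayMunster1994, strong-coupling cluster expansion: counting closed link-connected plaquette complexes of ℤ⁴ (the count bound itself is the tree's own, OURS)] -/
def step (s : State) (X : Finset (ZdPlaquette 4)) : State :=
  ⟨s.Y ∪ atLink (X \ s.Y) (sel (und Adm s)), insert (sel (und Adm s)) s.D⟩

/-- The Kraft parameter `x = 19/100`. [cite: MontvayMunster1994, strong-coupling cluster expansion: counting closed link-connected plaquette complexes of ℤ⁴ (the count bound itself is the tree's own, OURS)] -/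
def xK : ℝ := 19 / 100

/-- The per-present-plaquette factor `y = (1 + x)^{−2} = (100/119)²`. [cite: MontvayMunster1994, strong-coupling cluster expansion: counting closed link-connected plaquette complexes of ℤ⁴ (the count bound itself is the tree's own, OURS)] -/
def yK : ℝ := (100 / 119) ^ 2

/-- `0 < x`. [cite: MontvayMunster1994, strong-coupling cluster expansion: counting closed link-connected plaquette complexes of ℤ⁴ (the count bound itself is the tree's own, OURS)] -/
theorem xK_pos : 0 < xK := by unfold xK; norm_num

/-- `0 < y`. [cite: MontvayMunster1994, strong-coupling cluster expansion: counting closed link-connected plaquette complexes of ℤ⁴ (the count bound itself is the tree's own, OURS)] -/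
theorem yK_pos : 0 < yK := by unfold yK; positivity

/-- `y ≤ 1`. [cite: MontvayMunster1994, strong-coupling cluster expansion: counting closed link-connected plaquette complexes of ℤ⁴ (the count bound itself is the tree's own, OURS)] -/
theorem yK_le_one : yK ≤ 1 := by unfold yK; norm_num

/-- The weight of a block with `c` plaquettes already present at the decided link and `m` new-born ones: `[2 ≤ c + m]·x^m·y^c`. [cite: MontvayMunster1994, strong-coupling cluster expansion: counting closed link-connected plaquette complexes of ℤ⁴ (the count bound itself is the tree's own, OURS)] -/
def bw (c m : ℕ) : ℝ := if 2 ≤ c + m then xK ^ m * yK ^ c else 0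

/-- Block weights are nonnegative. [cite: MontvayMunster1994, strong-coupling cluster expansion: counting closed link-connected plaquette complexes of ℤ⁴ (the count bound itself is the tree's own, OURS)] -/
theorem bw_nonneg (c m : ℕ) : 0 ≤ bw c m := by
  unfold bw; split_ifs
  · exact mul_nonneg (pow_nonneg xK_pos.le _) (pow_nonneg yK_pos.le _)
  · exact le_rfl

/-- The weight of the run towards the target `X` from the state `s` with fuel `k`: product of the block weights, `1` at a terminal state whose born set
IS the target, `0` otherwise (wrong target or fuel exhausted). [cite: MontvayMunster1994, strong-coupling cluster expansion: counting closed link-connected plaquette complexes of ℤ⁴ (the count bound itself is the tree's own, OURS)] -/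
def wt : ℕ → State → Finset (ZdPlaquette 4) → ℝ
  | 0, s, X => if und Adm s = ∅ then (if s.Y = X then 1 else 0) else 0
  | k + 1, s, X => if und Adm s = ∅ then (if s.Y = X then 1 else 0) else
      bw (atLink s.Y (sel (und Adm s))).card (atLink (X \ s.Y) (sel (und Adm s))).card * wt k (step Adm s X) X

/-- At a terminal state the weight is the indicator of the target. [cite: MontvayMunster1994, strong-coupling cluster expansion: counting closed link-connected plaquette complexes of ℤ⁴ (the count bound itself is the tree's own, OURS)] -/
theorem wt_terminal {k : ℕ} {s : State} {X : Finset (ZdPlaquette 4)} (h : und Adm s = ∅) : wt Adm k s X = if s.Y = X then 1 else 0 := by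
  cases k <;> simp [wt, h]

/-- One block at a non-terminal state. [cite: MontvayMunster1994, strong-coupling cluster expansion: counting closed link-connected plaquette complexes of ℤ⁴ (the count bound itself is the tree's own, OURS)] -/
theorem wt_succ {k : ℕ} {s : State} {X : Finset (ZdPlaquette 4)} (h : und Adm s ≠ ∅) :
    wt Adm (k + 1) s X = bw (atLink s.Y (sel (und Adm s))).card (atLink (X \ s.Y) (sel (und Adm s))).card * wt Adm k (step Adm s X) X := by
  simp [wt, h]

/-- `Σ_{S ⊆ A} x^{|S|} = (1 + x)^{|A|}` (binomial theorem over the powerset). [cite: MontvayMunster1994, strong-coupling cluster expansion: counting closed link-connected plaquette complexes of ℤ⁴ (the count bound itself is the tree's own, OURS)] -/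
theorem sum_powerset_xK (A : Finset (ZdPlaquette 4)) : ∑ S ∈ A.powerset, xK ^ S.card = (xK + 1) ^ A.card := by
  have h := Finset.sum_pow_mul_eq_add_pow xK 1 A
  simpa using h

/-- Block weights with `c ≥ 2` plaquettes present: the indicator is `1`. [cite: MontvayMunster1994, strong-coupling cluster expansion: counting closed link-connected plaquette complexes of ℤ⁴ (the count bound itself is the tree's own, OURS)] -/
theorem bw_of_two_le {c : ℕ} (hc : 2 ≤ c) (m : ℕ) : bw c m = xK ^ m * yK ^ c := by
  unfold bw; rw [if_pos (by omega)]

/-- Block weights with one plaquette present: `x^m y − [m = 0]·y`. [cite: MontvayMunster1994, strong-coupling cluster expansion: counting closed link-connected plaquette complexes of ℤ⁴ (the count bound itself is the tree's own, OURS)] -/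
theorem bw_one (m : ℕ) : bw 1 m = xK ^ m * yK - if m = 0 then yK else 0 := by
  unfold bw
  rcases Nat.eq_zero_or_pos m with rfl | hm
  · simp
  · rw [if_pos (by omega), if_neg (by omega), pow_one, sub_zero]

/-- Root-block weights: `x^m − [m = 0] − [m = 1]·x`. [cite: MontvayMunster1994, strong-coupling cluster expansion: counting closed link-connected plaquette complexes of ℤ⁴ (the count bound itself is the tree's own, OURS)] -/
theorem bw_zero (m : ℕ) : bw 0 m = xK ^ m - (if m = 0 then 1 else 0) - (if m = 1 then xK else 0) := by
  unfold bw
  rcases Nat.lt_or_ge m 2 with hm | hm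
  · interval_cases m <;> simp
  · rw [if_pos (by omega), if_neg (by omega), if_neg (by omega), pow_zero, mul_one, sub_zero, sub_zero]

/-- `Σ_{S ⊆ A} bw 0 |S| = (1+x)^{|A|} − 1 − |A|·x`. [cite: MontvayMunster1994, strong-coupling cluster expansion: counting closed link-connected plaquette complexes of ℤ⁴ (the count bound itself is the tree's own, OURS)] -/
theorem sum_bw_zero (A : Finset (ZdPlaquette 4)) : ∑ S ∈ A.powerset, bw 0 S.card = (xK + 1) ^ A.card - 1 - A.card * xK := by
  simp_rw [bw_zero, sum_sub_distrib, sum_powerset_xK]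
  have h0 : ∑ S ∈ A.powerset, (if S.card = 0 then (1 : ℝ) else 0) = 1 := by
    rw [sum_ite, sum_const_zero, add_zero, sum_const, nsmul_eq_mul, mul_one, ← powersetCard_eq_filter, card_powersetCard,
      Nat.choose_zero_right, Nat.cast_one]
  have h1 : ∑ S ∈ A.powerset, (if S.card = 1 then xK else 0) = A.card * xK := by
    rw [sum_ite, sum_const_zero, add_zero, sum_const, nsmul_eq_mul, ← powersetCard_eq_filter, card_powersetCard, Nat.choose_one_right]
  rw [h0, h1]

/-- `Σ_{S ⊆ A} bw 1 |S| = ((1+x)^{|A|} − 1)·y`. [cite: MontvayMunster1994, strong-coupling cluster expansion: counting closed link-connected plaquette complexes of ℤ⁴ (the count bound itself is the tree's own, OURS)] -/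
theorem sum_bw_one (A : Finset (ZdPlaquette 4)) : ∑ S ∈ A.powerset, bw 1 S.card = ((xK + 1) ^ A.card - 1) * yK := by
  simp_rw [bw_one, sum_sub_distrib, ← sum_mul, sum_powerset_xK]
  have h0 : ∑ S ∈ A.powerset, (if S.card = 0 then yK else 0) = yK := by
    rw [sum_ite, sum_const_zero, add_zero, sum_const, nsmul_eq_mul, ← powersetCard_eq_filter, card_powersetCard,
      Nat.choose_zero_right, Nat.cast_one, one_mul]
  rw [h0]; ring

/-- `Σ_{S ⊆ A} bw c |S| = (1+x)^{|A|}·y^c` for `c ≥ 2`. [cite: MontvayMunster1994, strong-coupling cluster expansion: counting closed link-connected plaquette complexes of ℤ⁴ (the count bound itself is the tree's own, OURS)] -/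
theorem sum_bw_two_le {c : ℕ} (hc : 2 ≤ c) (A : Finset (ZdPlaquette 4)) :
    ∑ S ∈ A.powerset, bw c S.card = (xK + 1) ^ A.card * yK ^ c := by
  simp_rw [bw_of_two_le hc, ← sum_mul, sum_powerset_xK]

/-- The root block (at most six plaquettes through the root link): `Σ_{|S| ≥ 2} x^{|S|} ≤ (1.19)^6 − 1 − 6·(0.19) = 0.69976… ≤ 7/10`. [cite: MontvayMunster1994, strong-coupling cluster expansion: counting closed link-connected plaquette complexes of ℤ⁴ (the count bound itself is the tree's own, OURS)] -/
theorem kraft_root (A : Finset (ZdPlaquette 4)) (hA : A.card ≤ 6) : ∑ S ∈ A.powerset, bw 0 S.card ≤ 7 / 10 := by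
  rw [sum_bw_zero]
  obtain ⟨a, ha⟩ : ∃ a, A.card = a := ⟨_, rfl⟩
  rw [ha] at hA ⊢
  interval_cases a <;> (unfold xK; norm_num)

/-- **The per-block Kraft inequality** `Σ_{S ⊆ A} [2 ≤ c + |S|]·x^{|S|}·y^c ≤ 1` whenever `|A| + c ≤ 6` (`x = 19/100`, `y = (1+x)^{−2}`; binding cases
`(c, |A|) = (1, 5)`: `((1.19)^5 − 1)/(1.19)^2 = 0.979`, and `(2, 4)`: equality — the paper's LP vertex `ν₂ = 3/2`). [cite: MontvayMunster1994, strong-coupling cluster expansion: counting closed link-connected plaquette complexes of ℤ⁴ (the count bound itself is the tree's own, OURS)] -/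
theorem kraft_step (c : ℕ) (A : Finset (ZdPlaquette 4)) (h : A.card + c ≤ 6) : ∑ S ∈ A.powerset, bw c S.card ≤ 1 := by
  have h1x : (1 : ℝ) ≤ xK + 1 := by unfold xK; norm_num
  rcases Nat.lt_or_ge c 2 with hc | hc
  · interval_cases c
    · exact (kraft_root A (by omega)).trans (by norm_num)
    · rw [sum_bw_one]
      calc ((xK + 1) ^ A.card - 1) * yK ≤ ((xK + 1) ^ 5 - 1) * yK :=
            mul_le_mul_of_nonneg_right (sub_le_sub_right (pow_le_pow_right₀ h1x (by omega)) _) yK_pos.le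
        _ ≤ 1 := by unfold xK yK; norm_num
  · rw [sum_bw_two_le hc]
    calc (xK + 1) ^ A.card * yK ^ c ≤ (xK + 1) ^ 4 * yK ^ 2 :=
          mul_le_mul (pow_le_pow_right₀ h1x (by omega)) (pow_le_pow_of_le_one yK_pos.le yK_le_one hc) (pow_nonneg yK_pos.le _)
            (pow_nonneg (zero_le_one.trans h1x) _)
      _ = 1 := by unfold xK yK; norm_num

/-- At most six plaquettes of `ℤ⁴` through a link, split into those already born and the rest. [cite: MontvayMunster1994, strong-coupling cluster expansion: counting closed link-connected plaquette complexes of ℤ⁴ (the count bound itself is the tree's own, OURS)] -/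
theorem card_sdiff_add_card_atLink_le (Y : Finset (ZdPlaquette 4)) (l : ZdEdge 4) :
    (plaquettesTouching {l} \ Y).card + (atLink Y l).card ≤ 6 := by
  have hsub : plaquettesTouching {l} \ Y ∪ atLink Y l ⊆ plaquettesTouching {l} := by
    intro p hp
    rcases mem_union.1 hp with hp | hp
    · exact (mem_sdiff.1 hp).1
    · exact mem_plaquettesTouching_singleton.2 (mem_filter.1 hp).2
  have hdisj : Disjoint (plaquettesTouching {l} \ Y) (atLink Y l) := disjoint_sdiff_self_left.mono_right (filter_subset _ _)
  rw [← card_union_of_disjoint hdisj]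
  exact (card_le_card hsub).trans ((card_plaquettesTouching_singleton_le l).trans (by norm_num))

/-- **Kraft inequality.** From any state, with any fuel, the run weights of any family of distinct targets sum to at most `1`. [cite: MontvayMunster1994, strong-coupling cluster expansion: counting closed link-connected plaquette complexes of ℤ⁴ (the count bound itself is the tree's own, OURS)] -/
theorem kraft : ∀ (k : ℕ) (s : State) (𝒳 : Finset (Finset (ZdPlaquette 4))), ∑ X ∈ 𝒳, wt Adm k s X ≤ 1 := by
  have hterm : ∀ (k : ℕ) (s : State) (𝒳 : Finset (Finset (ZdPlaquette 4))), und Adm s = ∅ → ∑ X ∈ 𝒳, wt Adm k s X ≤ 1 := by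
    intro k s 𝒳 h
    simp_rw [wt_terminal Adm h]
    rw [sum_ite_eq]
    split_ifs <;> norm_num
  intro k
  induction k with
  | zero =>
    intro s 𝒳
    by_cases h : und Adm s = ∅
    · exact hterm 0 s 𝒳 h
    · have : ∀ X ∈ 𝒳, wt Adm 0 s X = 0 := fun X _ => by simp [wt, h]
      rw [sum_congr rfl this, sum_const_zero]; exact zero_le_one
  | succ k ih =>
    intro s 𝒳
    by_cases h : und Adm s = ∅
    · exact hterm (k + 1) s 𝒳 h
    · have hrw0 : ∀ X ∈ 𝒳, wt Adm (k + 1) s X =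
          bw (atLink s.Y (sel (und Adm s))).card (atLink (X \ s.Y) (sel (und Adm s))).card *
            wt Adm k ⟨s.Y ∪ atLink (X \ s.Y) (sel (und Adm s)), insert (sel (und Adm s)) s.D⟩ X := fun X _ => wt_succ Adm h
      rw [sum_congr rfl hrw0]
      generalize sel (und Adm s) = l
      have hmaps : ∀ X ∈ 𝒳, atLink (X \ s.Y) l ∈ (plaquettesTouching {l} \ s.Y).powerset := by
        intro X _
        rw [mem_powerset]
        intro p hp
        obtain ⟨hp1, hp2⟩ := mem_filter.1 hp
        exact mem_sdiff.2 ⟨mem_plaquettesTouching_singleton.2 hp2, (mem_sdiff.1 hp1).2⟩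
      rw [← sum_fiberwise_of_maps_to hmaps]
      have hfib : ∀ S ∈ (plaquettesTouching {l} \ s.Y).powerset,
          ∑ X ∈ 𝒳 with atLink (X \ s.Y) l = S,
              bw (atLink s.Y l).card (atLink (X \ s.Y) l).card * wt Adm k ⟨s.Y ∪ atLink (X \ s.Y) l, insert l s.D⟩ X
            ≤ bw (atLink s.Y l).card S.card := by
        intro S _
        have hrw : ∀ X ∈ 𝒳.filter (fun X => atLink (X \ s.Y) l = S),
            bw (atLink s.Y l).card (atLink (X \ s.Y) l).card * wt Adm k ⟨s.Y ∪ atLink (X \ s.Y) l, insert l s.D⟩ X =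
              bw (atLink s.Y l).card S.card * wt Adm k ⟨s.Y ∪ S, insert l s.D⟩ X := by
          intro X hX
          rw [(mem_filter.1 hX).2]
        rw [sum_congr rfl hrw, ← mul_sum]
        calc bw (atLink s.Y l).card S.card * ∑ X ∈ 𝒳 with atLink (X \ s.Y) l = S, wt Adm k ⟨s.Y ∪ S, insert l s.D⟩ X
            ≤ bw (atLink s.Y l).card S.card * 1 := mul_le_mul_of_nonneg_left (ih _ _) (bw_nonneg _ _)
          _ = bw (atLink s.Y l).card S.card := mul_one _
      exact (sum_le_sum hfib).trans (kraft_step _ _ (card_sdiff_add_card_atLink_le s.Y l))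

/-- The initial state of the exploration of `X` from the root link `e`: the plaquettes of `X` through `e` are born, `e` is decided. [cite: MontvayMunster1994, strong-coupling cluster expansion: counting closed link-connected plaquette complexes of ℤ⁴ (the count bound itself is the tree's own, OURS)] -/
def init (e : ZdEdge 4) (X : Finset (ZdPlaquette 4)) : State := ⟨atLink X e, {e}⟩

/-- The total weight of the target `X` among `n`-complexes through `e`: root block `[2 ≤ m₀]·x^{m₀}` times the run weight from the initial state with
fuel `4n`. [cite: MontvayMunster1994, strong-coupling cluster expansion: counting closed link-connected plaquette complexes of ℤ⁴ (the count bound itself is the tree's own, OURS)] -/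
def W (e : ZdEdge 4) (n : ℕ) (X : Finset (ZdPlaquette 4)) : ℝ := bw 0 (atLink X e).card * wt Adm (4 * n) (init e X) X

/-- **Kraft inequality with the root block**: the total weights of any family of distinct targets sum to at most `7/10`. [cite: MontvayMunster1994, strong-coupling cluster expansion: counting closed link-connected plaquette complexes of ℤ⁴ (the count bound itself is the tree's own, OURS)] -/
theorem kraft_root_sum (e : ZdEdge 4) (n : ℕ) (𝒳 : Finset (Finset (ZdPlaquette 4))) : ∑ X ∈ 𝒳, W Adm e n X ≤ 7 / 10 := by
  have hmaps : ∀ X ∈ 𝒳, atLink X e ∈ (plaquettesTouching {e}).powerset := by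
    intro X _
    rw [mem_powerset]
    intro p hp
    exact mem_plaquettesTouching_singleton.2 (mem_filter.1 hp).2
  rw [← sum_fiberwise_of_maps_to hmaps]
  have hfib : ∀ S ∈ (plaquettesTouching {e}).powerset, ∑ X ∈ 𝒳 with atLink X e = S, W Adm e n X ≤ bw 0 S.card := by
    intro S _
    have hrw : ∀ X ∈ 𝒳.filter (fun X => atLink X e = S), W Adm e n X = bw 0 S.card * wt Adm (4 * n) ⟨S, {e}⟩ X := by
      intro X hX
      have hS : atLink X e = S := (mem_filter.1 hX).2
      unfold W init
      rw [hS]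
    rw [sum_congr rfl hrw, ← mul_sum]
    calc bw 0 S.card * ∑ X ∈ 𝒳 with atLink X e = S, wt Adm (4 * n) ⟨S, {e}⟩ X
        ≤ bw 0 S.card * 1 := mul_le_mul_of_nonneg_left (kraft Adm _ _ _) (bw_nonneg _ _)
      _ = bw 0 S.card := mul_one _
  exact (sum_le_sum hfib).trans (kraft_root _ ((card_plaquettesTouching_singleton_le e).trans (by norm_num)))

end Literature.MathematicalPhysics.QuantumFieldTheory.Balaban1983to89.ClosedComplexes.ClosedComplexExploration

end Part2

/-!
## Part 3 — port of `Summits/QuantumFields/YangMills/Theorems/Instrument/ClosedComplexCountDFSBound.lean` (12 declarations kept)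

# Instrument cell `ym-instrument`, crew (b): the DFS-contour (Friedli–Velenik Lemma 3.38) sharpening of the kernel lattice-animal tail —
# `#{connected (n+1)-sets through v} ≤ C(2n, n)·Δⁿ` generically, hence `closedCount 4 n ≤ 6·C(2n−2, n−1)·20^(n−1) ≤ 6·80^(n−1)`

QUESTIONS.md rows: Q-B1 (REGISTERED 2026-08-26T13:54:11Z; readings A-0826-8, A-0826-16); certs/b/FORMAT.md v1.4 §3b (`counts`/`tail` columns); cell
`run/shared/lean/pub/ym-instrument/`, HUMAN RULING D-0084 (2), director-ym R138.  HONEST FRAMING (page 1, binding).  WHAT IS CERTIFIED HERE AND AT WHICH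
`(G, D, L, β)`: PURE COMBINATORICS (no group, no coupling, no measure).  §1 is a GENERIC counting theorem for any type `V` with neighbour lists
`nbr x` of size `≤ Δ`: the finite sets `S ∋ v` of cardinality `n + 1` that are connected inside themselves from `v` number at most `C(2n, n)·Δⁿ ≤ (4Δ)ⁿ` —
the depth-first CONTOUR refinement of the tree's lazy-walk count `(Δ+1)^{2n}` (`Literature.Probability.LatticeModels.LatticeAnimals.card_connectedFamily_le`):
a connected set is the vertex set of a push/pop code of length `2n` with exactly `n` pushes, each push choosing a listed neighbour of the current stack top
(existence by splicing `[push y, pop]` at a moment when the parent is on top — the splice argument of `LatticeAnimals.exists_lazyWalk_cover` with the return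
step made free; first-exit lemma `LatticeAnimals.exists_step_out` BY NAME), and such codes number `≤ C(2n, n)·Δⁿ` (Pascal recursion).  §2 instantiates it on the
plaquettes of `ℤ⁴` with the share-a-link adjacency of the landed `ClosedComplexCountBound` (`Δ = 20`, six root plaquettes): ★ `closedCount 4 n ≤ 6·C(2n−2, n−1)·20^(n−1)`
for `n ≥ 1`, i.e. growth `80` per plaquette instead of `441`.  WHAT THIS IS FOR: the hypothesis-free typed Kotecký–Preiss window of the companion rows file
moves from `β_W = 0.00165` (tail `6·441^{n−1}`, landed `KPCriterionSU2Unconditional`) to `≈ 0.0075` — still a NUMBER INSIDE `[0, 0.328)` (A-0826-16), a factor `6`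
inside the certified-conditional `r★ = 0.047` (T2, counts) and a factor `38` inside the SC-c door `2/7`; it converts nothing but the typed constant.  NOT a
clustering statement, NOT a mass gap, NOT summit-bearing.  Grade (T): every statement below is a hypothesis-free kernel theorem.  (Librarian note: §1 is
model-independent and may be re-homed next to `LatticeAnimals`; [cite: FriedliVelenik2017, Lemma 3.38 and eq. (5.27)].)

(Verbatim declaration-level port — the declarations listed in the Part header count — of the Summits-side module of the YangMills
instrument cell; cell / crew / ruling bookkeeping in the text above is historical.)
-/

section Part3

open _root_.Finset
open Literature.MathematicalPhysics.QuantumLattice (ZdEdge ZdPlaquette plaquetteEdges plaquettesTouching)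
open Literature.MathematicalPhysics.QuantumFieldTheory (mem_plaquettesTouching_singleton card_plaquettesTouching_singleton_le)
open Literature.MathematicalPhysics.QuantumFieldTheory.Balaban1983to89.StrongCouplingKPWindow (links IsClosedComplex IsLinkConnected rootLink closedCount)
open Literature.Probability.LatticeModels (exists_step_out)
open Literature.MathematicalPhysics.QuantumFieldTheory.Balaban1983to89.ClosedComplexes.ClosedComplexCountBound (nbr card_nbr_le_twenty adj_symm mem_nbr_of_adj reflTransGen_adj_of_isLinkConnected)

namespace Literature.MathematicalPhysics.QuantumFieldTheory.Balaban1983to89.ClosedComplexes.ClosedComplexCountDFSBound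

/-! ## §1 Generic: push/pop (depth-first contour) codes of connected sets -/

section Generic

variable {V : Type*} [DecidableEq V] (nb : V → Finset V)

/-- A code is a list of moves `some y` (push the listed neighbour `y` of the current stack top) / `none` (pop).  `ValidFrom nb st c`: the code `c` is
executable from the stack `st` (every push is a listed neighbour of the top; pops are always allowed, idle on the empty stack). [cite: MontvayMunster1994, strong-coupling cluster expansion: counting closed link-connected plaquette complexes of ℤ⁴ (the count bound itself is the tree's own, OURS)] -/
def ValidFrom : List V → List (Option V) → Prop
  | _, [] => True
  | st, none :: c => ValidFrom st.tail c
  | [], some _ :: _ => False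
  | x :: st, some y :: c => y ∈ nb x ∧ ValidFrom (y :: x :: st) c

/-- The stack after executing a code. [cite: MontvayMunster1994, strong-coupling cluster expansion: counting closed link-connected plaquette complexes of ℤ⁴ (the count bound itself is the tree's own, OURS)] -/
def stackAfter : List V → List (Option V) → List V
  | st, [] => st
  | st, none :: c => stackAfter st.tail c
  | st, some y :: c => stackAfter (y :: st) c

omit [DecidableEq V] in
/-- `stackAfter` over a concatenation. [cite: MontvayMunster1994, strong-coupling cluster expansion: counting closed link-connected plaquette complexes of ℤ⁴ (the count bound itself is the tree's own, OURS)] -/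
theorem stackAfter_append (st : List V) (a b : List (Option V)) : stackAfter st (a ++ b) = stackAfter (stackAfter st a) b := by
  induction a generalizing st with
  | nil => rfl
  | cons m a ih =>
    cases m with
    | none => exact ih st.tail
    | some y => exact ih (y :: st)

omit [DecidableEq V] in
/-- Validity over a concatenation: valid from `st` on `a`, then valid from the resulting stack on `b`. [cite: MontvayMunster1994, strong-coupling cluster expansion: counting closed link-connected plaquette complexes of ℤ⁴ (the count bound itself is the tree's own, OURS)] -/
theorem validFrom_append {st : List V} {a b : List (Option V)} : ValidFrom nb st (a ++ b) ↔ ValidFrom nb st a ∧ ValidFrom nb (stackAfter st a) b := by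
  induction a generalizing st with
  | nil => simp [ValidFrom, stackAfter]
  | cons m a ih =>
    cases m with
    | none =>
      simp only [List.cons_append, ValidFrom, stackAfter]
      exact ih
    | some y =>
      cases st with
      | nil => simp [ValidFrom]
      | cons x st =>
        simp only [List.cons_append, ValidFrom, stackAfter]
        rw [ih, and_assoc]

/-- The number of pushes of a code. [cite: MontvayMunster1994, strong-coupling cluster expansion: counting closed link-connected plaquette complexes of ℤ⁴ (the count bound itself is the tree's own, OURS)] -/
def pushes (c : List (Option V)) : ℕ := (c.filterMap id).length

/-- The decoded vertex set: the start vertex and every pushed vertex. [cite: MontvayMunster1994, strong-coupling cluster expansion: counting closed link-connected plaquette complexes of ℤ⁴ (the count bound itself is the tree's own, OURS)] -/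
def decode (v : V) (c : List (Option V)) : Finset V := insert v (c.filterMap id).toFinset

omit [DecidableEq V] in
/-- `pushes` is additive. [cite: MontvayMunster1994, strong-coupling cluster expansion: counting closed link-connected plaquette complexes of ℤ⁴ (the count bound itself is the tree's own, OURS)] -/
theorem pushes_append (a b : List (Option V)) : pushes (a ++ b) = pushes a + pushes b := by
  simp [pushes, List.filterMap_append]

/-- ★ The finite set of valid codes of length `m` with exactly `k` pushes from the stack `st` (structural recursion on `m`). [cite: MontvayMunster1994, strong-coupling cluster expansion: counting closed link-connected plaquette complexes of ℤ⁴ (the count bound itself is the tree's own, OURS)] -/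
def codes : List V → ℕ → ℕ → Finset (List (Option V))
  | _, 0, 0 => {[]}
  | _, 0, _ + 1 => ∅
  | [], m + 1, k => (codes [] m k).image (List.cons none)
  | _ :: st, m + 1, 0 => (codes st m 0).image (List.cons none)
  | x :: st, m + 1, k + 1 => (codes st m (k + 1)).image (List.cons none) ∪
      (nb x).biUnion fun y => (codes (y :: x :: st) m k).image (List.cons (some y))

/-- ★ **Counting codes (Pascal)**: `#codes st m k ≤ C(m, k)·Δᵏ` when every neighbour list has `≤ Δ` entries. [cite: MontvayMunster1994, strong-coupling cluster expansion: counting closed link-connected plaquette complexes of ℤ⁴ (the count bound itself is the tree's own, OURS)] -/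
theorem card_codes_le {Δ : ℕ} (hΔ : ∀ x, (nb x).card ≤ Δ) : ∀ (m : ℕ) (st : List V) (k : ℕ), (codes nb st m k).card ≤ m.choose k * Δ ^ k
  | 0, st, 0 => by simp [codes]
  | 0, st, k + 1 => by simp [codes]
  | m + 1, [], k => by
    simp only [codes]
    refine card_image_le.trans ((card_codes_le hΔ m [] k).trans ?_)
    exact Nat.mul_le_mul_right _ (Nat.choose_le_choose k (Nat.le_succ m))
  | m + 1, x :: st, 0 => by
    simp only [codes]
    refine card_image_le.trans ((card_codes_le hΔ m st 0).trans ?_)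
    simp
  | m + 1, x :: st, k + 1 => by
    simp only [codes]
    refine (card_union_le _ _).trans ?_
    have h1 : ((codes nb st m (k + 1)).image (List.cons none)).card ≤ m.choose (k + 1) * Δ ^ (k + 1) :=
      card_image_le.trans (card_codes_le hΔ m st (k + 1))
    have h2 : ((nb x).biUnion fun y => (codes nb (y :: x :: st) m k).image (List.cons (some y))).card ≤ Δ * (m.choose k * Δ ^ k) :=
      (card_biUnion_le_card_mul _ _ _ fun y _ => card_image_le.trans (card_codes_le hΔ m _ k)).trans (Nat.mul_le_mul_right _ (hΔ x))
    calc _ ≤ m.choose (k + 1) * Δ ^ (k + 1) + Δ * (m.choose k * Δ ^ k) := Nat.add_le_add h1 h2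
      _ = (m + 1).choose (k + 1) * Δ ^ (k + 1) := by rw [Nat.choose_succ_succ, pow_succ]; ring

/-- A valid code of length `m` with `k` pushes from `st` is listed in `codes st m k`. [cite: MontvayMunster1994, strong-coupling cluster expansion: counting closed link-connected plaquette complexes of ℤ⁴ (the count bound itself is the tree's own, OURS)] -/
theorem mem_codes {c : List (Option V)} : ∀ {st : List V} {m k : ℕ}, c.length = m → pushes c = k → ValidFrom nb st c → c ∈ codes nb st m k := by
  induction c with
  | nil =>
    intro st m k hl hp _
    simp only [List.length_nil] at hl
    simp only [pushes, List.filterMap_nil, List.length_nil] at hp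
    subst hl; subst hp
    cases st <;> simp [codes]
  | cons mv c ih =>
    intro st m k hl hp hv
    obtain ⟨m', rfl⟩ : ∃ m', m = m' + 1 := ⟨c.length, by simpa using hl.symm⟩
    have hl' : c.length = m' := by simpa using hl
    cases mv with
    | none =>
      have hp' : pushes c = k := by simpa [pushes] using hp
      have hv' : ValidFrom nb st.tail c := hv
      have hmem := ih hl' hp' hv'
      cases st with
      | nil => simp only [codes]; exact mem_image_of_mem _ hmem
      | cons x st =>
        cases k with
        | zero => simp only [codes]; exact mem_image_of_mem _ hmem
        | succ k => simp only [codes]; exact mem_union_left _ (mem_image_of_mem _ hmem)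
    | some y =>
      cases st with
      | nil => exact absurd hv (by simp [ValidFrom])
      | cons x st =>
        obtain ⟨hy, hv'⟩ : y ∈ nb x ∧ ValidFrom nb (y :: x :: st) c := hv
        obtain ⟨k', rfl⟩ : ∃ k', k = k' + 1 := ⟨pushes c, by simpa [pushes] using hp.symm⟩
        have hp' : pushes c = k' := by simpa [pushes] using hp
        have hmem := ih hl' hp' hv'
        simp only [codes]
        exact mem_union_right _ (mem_biUnion.2 ⟨y, hy, mem_image_of_mem _ hmem⟩)

/-- If `x` is decoded, the code splits at a moment when `x` is on top of the stack (start, or right after `x` is pushed). [cite: MontvayMunster1994, strong-coupling cluster expansion: counting closed link-connected plaquette complexes of ℤ⁴ (the count bound itself is the tree's own, OURS)] -/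
theorem exists_split_top {v x : V} {c : List (Option V)} (hx : x ∈ decode v c) :
    ∃ c₁ c₂ : List (Option V), ∃ rest : List V, c = c₁ ++ c₂ ∧ stackAfter [v] c₁ = x :: rest := by
  unfold decode at hx
  rcases mem_insert.1 hx with rfl | hx'
  · exact ⟨[], c, [], by simp, rfl⟩
  · rw [List.mem_toFinset, List.mem_filterMap] at hx'
    obtain ⟨a, ha, hax⟩ := hx'
    have hax' : a = some x := by simpa using hax
    subst hax'
    obtain ⟨s, t, rfl⟩ := List.append_of_mem ha
    refine ⟨s ++ [some x], t, stackAfter [v] s, by simp, ?_⟩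
    rw [stackAfter_append]
    rfl

/-- ★ **Covering codes.**  If every point of the finite set `S` is joined to `v ∈ S` by a chain of `R`-steps inside `S` (`nb` listing the `R`-neighbours),
then `S` is decoded by a valid push/pop code from `[v]` of length `2(#S − 1)` with `#S − 1` pushes. [cite: MontvayMunster1994, strong-coupling cluster expansion: counting closed link-connected plaquette complexes of ℤ⁴ (the count bound itself is the tree's own, OURS)] -/
theorem exists_code_cover {R : V → V → Prop} (hnb : ∀ x y, R x y → y ∈ nb x) {S : Finset V} {v : V} (hv : v ∈ S)
    (hS : ∀ w ∈ S, Relation.ReflTransGen (fun x y => R x y ∧ x ∈ S ∧ y ∈ S) v w) :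
    ∃ c : List (Option V), c.length = 2 * (S.card - 1) ∧ pushes c = S.card - 1 ∧ ValidFrom nb [v] c ∧ decode v c = S := by
  have key : ∀ j, j + 1 ≤ S.card → ∃ T ⊆ S, v ∈ T ∧ T.card = j + 1 ∧
      ∃ c : List (Option V), c.length = 2 * j ∧ pushes c = j ∧ ValidFrom nb [v] c ∧ decode v c = T := by
    intro j
    induction j with
    | zero =>
      intro _
      exact ⟨{v}, by simpa using hv, mem_singleton_self v, card_singleton v, [], rfl, rfl, trivial, by simp [decode]⟩
    | succ j ih =>
      intro hj
      obtain ⟨T, hTS, hvT, hTcard, c, hlen, hpush, hval, hdec⟩ := ih (by omega)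
      obtain ⟨s, hsS, hsT⟩ : ∃ s ∈ S, s ∉ T := by
        by_contra h
        push Not at h
        have := card_le_card (show S ⊆ T from h)
        omega
      obtain ⟨x, y, hxT, hyT, hyS, hxy⟩ := exists_step_out (hS s hsS) hvT hsT
      have hxdec : x ∈ decode v c := hdec ▸ hxT
      obtain ⟨c₁, c₂, rest, rfl, htop⟩ := exists_split_top hxdec
      refine ⟨insert y T, insert_subset hyS hTS, mem_insert_of_mem hvT, by rw [card_insert_of_notMem hyT, hTcard],
        c₁ ++ (some y :: none :: c₂), ?_, ?_, ?_, ?_⟩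
      · simp only [List.length_append, List.length_cons] at hlen ⊢
        omega
      · rw [pushes_append] at hpush ⊢
        simp only [pushes, List.filterMap_cons] at hpush ⊢
        simp only [id, List.length_cons] at hpush ⊢
        omega
      · rw [validFrom_append] at hval ⊢
        refine ⟨hval.1, ?_⟩
        rw [htop] at hval ⊢
        exact ⟨hnb x y hxy, hval.2⟩
      · rw [← hdec]
        ext z
        simp only [decode, List.filterMap_append, List.filterMap_cons, id, mem_insert, List.mem_toFinset, List.mem_append, List.mem_cons]
        tauto
  have hcard : 1 ≤ S.card := card_pos.2 ⟨v, hv⟩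
  obtain ⟨T, hTS, -, hTcard, c, hlen, hpush, hval, hdec⟩ := key (S.card - 1) (by omega)
  have hTS' : T = S := eq_of_subset_of_card_le hTS (by omega)
  exact ⟨c, hlen, hpush, hval, hdec.trans hTS'⟩

end Generic

end Literature.MathematicalPhysics.QuantumFieldTheory.Balaban1983to89.ClosedComplexes.ClosedComplexCountDFSBound

end Part3

/-!
## Part 4 — port of `Summits/QuantumFields/YangMills/Theorems/Instrument/AdmissibleLinkComplexCount.lean` (4 declarations kept)

# Instrument cell `ym-instrument`, crew (b): the hypothesis-free COUNT FALLBACK for polymer classes connected through a SUB-family of links (S2-SPEC v0.3 (G4)) —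
# complexes of `ℤ⁴` through an ARBITRARY fixed link, connected through «admissible» shared links, number `≤ 6·C(2n−2, n−1)·20^(n−1)` whatever the admissibility rule

QUESTIONS.md: Q-B2 ∕ J-B2a (A-0826-25, A-0826-32; S2-SPEC v0.3 `ym-instrument-sc-plan/S2-SPEC.md` 777d8c3364670be5 §1a (G1) polymer class «fine plaquette sets connected through
shared FREE links», (G4) hypothesis-free fallback; sc-plan g2 2026-08-26T23:13:47Z ask (b); sc-ref g2 22:14:09Z ∕ 23:00:44Z); cell `run/shared/lean/pub/ym-instrument/`, HUMAN RULING
D-0084 (2), director-ym R138.  HONEST FRAMING (page 1, binding).  WHAT IS CERTIFIED HERE AND AT WHICH `(G, D, L, β)`: PURE COMBINATORICS of `ℤ⁴` (no group, no coupling, no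
block map): for ANY predicate `Adm` on links («admissible» = e.g. the FREE links of the axial-2 comb gauge of S2-SPEC §1a — the instantiation is the spec's, not this file's) and
ANY side condition `P` (e.g. «every free link in ≥ 2 plaquettes»), the `n`-plaquette sets of `ℤ⁴` containing a FIXED link `e` and connected inside themselves through shared
ADMISSIBLE links number at most ★ `6·C(2n−2, n−1)·20^(n−1) ≤ 6·80^(n−1)` — because admissible-link connectivity implies link connectivity (`isLinkConnected_of_isAdmConnected`)
and the landed DFS-contour count (`ClosedComplexCountDFSBound`: codes ∕ `exists_code_cover` ∕ `card_codes_le`, `Δ = 20`, `≤ 6` plaquettes through any link) is re-run at an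
arbitrary root link (`card_linkConnected_through_le`; the landed `closedCount_four_le_choose` is the special case `e = rootLink 4`, `P = IsClosedComplex`).  WHAT THIS IS FOR: the
(G4) «kernel-disc fallback» of the S2 (α) remainder — a tiny UNCONDITIONAL Kotecký–Preiss disc for the (G1) gas by the engines of `KPCriterionSU2UnconditionalDFS` once its activity
column is fixed; the (α) window proper stays OPEN until T2′ (census + tail for the (G1) class) exists (A-0826-32).  NOT a statement about any gauge theory, NOT a radius by
itself, NOT summit-bearing.  Grade (T).

(Verbatim declaration-level port — the declarations listed in the Part header count — of the Summits-side module of the YangMills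
instrument cell; cell / crew / ruling bookkeeping in the text above is historical.)
-/

section Part4

open _root_.Finset
open Literature.MathematicalPhysics.QuantumLattice (ZdEdge ZdPlaquette plaquetteEdges plaquettesTouching)
open Literature.MathematicalPhysics.QuantumFieldTheory (mem_plaquettesTouching_singleton card_plaquettesTouching_singleton_le)
open Literature.MathematicalPhysics.QuantumFieldTheory.Balaban1983to89.StrongCouplingKPWindow (links IsLinkConnected)
open Literature.MathematicalPhysics.QuantumFieldTheory.Balaban1983to89.ClosedComplexes.ClosedComplexCountBound (nbr card_nbr_le_twenty mem_nbr_of_adj reflTransGen_adj_of_isLinkConnected)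
open Literature.MathematicalPhysics.QuantumFieldTheory.Balaban1983to89.ClosedComplexes.ClosedComplexCountDFSBound (codes decode card_codes_le mem_codes exists_code_cover)

namespace Literature.MathematicalPhysics.QuantumFieldTheory.Balaban1983to89.ClosedComplexes.AdmissibleLinkComplexCount

/-! ## §1 Connectivity through admissible links implies link connectivity -/

/-- A finite plaquette set is **connected through admissible links** (`Adm`-connected) when any two of its plaquettes are joined inside it by a chain of plaquettes,
consecutive ones sharing a link `e` with `Adm e` (S2-SPEC (G1): `Adm` = «free link»; incompatibility = sharing an admissible link). [cite: MontvayMunster1994, strong-coupling cluster expansion: counting closed link-connected plaquette complexes of ℤ⁴ (the count bound itself is the tree's own, OURS)] -/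
def IsAdmConnected (Adm : ZdEdge 4 → Prop) (X : Finset (ZdPlaquette 4)) : Prop :=
  ∀ p ∈ X, ∀ q ∈ X, Relation.ReflTransGen (fun a b => a ∈ X ∧ b ∈ X ∧ ∃ e, Adm e ∧ e ∈ plaquetteEdges a ∧ e ∈ plaquetteEdges b) p q

/-- `Adm`-connected ⟹ link-connected (the tree's `IsLinkConnected`): a shared admissible link is a shared link. [cite: MontvayMunster1994, strong-coupling cluster expansion: counting closed link-connected plaquette complexes of ℤ⁴ (the count bound itself is the tree's own, OURS)] -/
theorem isLinkConnected_of_isAdmConnected {Adm : ZdEdge 4 → Prop} {X : Finset (ZdPlaquette 4)} (h : IsAdmConnected Adm X) : IsLinkConnected X := by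
  intro p hp q hq
  have hpq := h p hp q hq
  clear hq
  induction hpq with
  | refl => exact Relation.ReflTransGen.refl
  | @tail b c _ hbc ih =>
    obtain ⟨hb, hc, e, -, hea, heb⟩ := hbc
    exact ih.tail ⟨hb, hc, not_disjoint_iff.2 ⟨e, hea, heb⟩⟩

/-! ## §2 The DFS-contour count through an ARBITRARY fixed link -/

/-- Decoded push∕pop codes of length `2(n−1)` with `n−1` pushes from one of the (at most six) plaquettes through the link `e`. [cite: MontvayMunster1994, strong-coupling cluster expansion: counting closed link-connected plaquette complexes of ℤ⁴ (the count bound itself is the tree's own, OURS)] -/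
def dfsFamilyAt (e : ZdEdge 4) (n : ℕ) : Finset (Finset (ZdPlaquette 4)) :=
  (plaquettesTouching {e}).biUnion fun p => (codes nbr [p] (2 * (n - 1)) (n - 1)).image (decode p)

/-- Every link-connected `n`-complex through `e` belongs to `dfsFamilyAt e n` (`ClosedComplexCountDFSBound.exists_code_cover` BY NAME). [cite: MontvayMunster1994, strong-coupling cluster expansion: counting closed link-connected plaquette complexes of ℤ⁴ (the count bound itself is the tree's own, OURS)] -/
theorem mem_dfsFamilyAt {e : ZdEdge 4} {n : ℕ} {X : Finset (ZdPlaquette 4)} (hcard : X.card = n) (he : e ∈ links X) (hconn : IsLinkConnected X) :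
    X ∈ dfsFamilyAt e n := by
  unfold links at he
  obtain ⟨p, hpX, hpe⟩ := mem_biUnion.1 he
  have hS := reflTransGen_adj_of_isLinkConnected hconn hpX
  obtain ⟨c, hlen, hpush, hval, hdec⟩ := exists_code_cover nbr
    (R := fun x y : ZdPlaquette 4 => x ≠ y ∧ ¬ Disjoint (plaquetteEdges x) (plaquetteEdges y)) (fun _ _ h => mem_nbr_of_adj h) hpX hS
  rw [hcard] at hlen hpush
  unfold dfsFamilyAt
  exact mem_biUnion.2 ⟨p, mem_plaquettesTouching_singleton.2 hpe, mem_image.2 ⟨c, mem_codes nbr hlen hpush hval, hdec⟩⟩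

end Literature.MathematicalPhysics.QuantumFieldTheory.Balaban1983to89.ClosedComplexes.AdmissibleLinkComplexCount

end Part4

/-!
## Part 5 — port of `Summits/QuantumFields/YangMills/Theorems/Instrument/ClosedComplexTailBound.lean` (28 declarations kept)

# Instrument cell `ym-instrument`, crew (b): the tree's tail obligation `TailBoundT2` DISCHARGED — `closedCount 4 n ≤ (7/10)·(299/20)^n` for every `n` —
# and its (G1) twin T2′: the same bound for complexes connected and closed through ANY admissible-link class (part 2; part 1 = `ClosedComplexExploration`)

QUESTIONS.md: Q-B1 (A-0826-8 reading (i) REACH; certs/b radius∕rate rows of record carry `conditional_on ["T2"]` = exactly this obligation).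
Cell `run/shared/lean/pub/ym-instrument/`, HUMAN RULING D-0084 (2), director-ym R138.  HONEST FRAMING (page 1, binding).  WHAT IS CERTIFIED HERE
AND AT WHICH `(G, D, L, β)`: PURE COMBINATORICS of `ℤ⁴` (no group, no coupling, no volume): the number `closedCount 4 n` of CLOSED (every link in `≥ 2`
plaquettes), LINK-CONNECTED sets of `n` plaquettes of `ℤ⁴` through the fixed root link obeys ★ `closedCount 4 n ≤ (7/10)·((100/19)·(119/100)^6)^n
≤ (7/10)·(299/20)^n = 0.7·14.95ⁿ` for EVERY `n` — the statement of the tree's NAMED OBLIGATION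
`Balaban1983to89.StrongCouplingKPWindow.TailBoundT2` («analysis grade, NOT proved in the tree — a named `Prop` a prover may discharge»), now a
hypothesis-free kernel theorem `tailBoundT2_holds : TailBoundT2`; and, for ANY link predicate `Adm` and any root link `e` with `Adm e`, the number of
`n`-plaquette sets through `e` that are `Adm`-CONNECTED (`AdmissibleLinkComplexCount.IsAdmConnected`) and CLOSED ON THEIR ADMISSIBLE LINKS (`AdmClosed`: every
admissible link of the set in `≥ 2` of its plaquettes; other links unconstrained) obeys the same bound (`admClosedCount_le_T2`) — the typed form of sc-eng-2's
T2′ (2026-08-27T00:09:38Z) for S2-SPEC v0.5 (G1)∕(G3) once instantiated at `Adm :=` «free link of the axial-2 comb gauge» (the instantiation is the spec's).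
PROOF (the paper proof `pub-balaban/ir/data/FRONT-SC-taillemma.txt` steps (1)–(6), typed; machine = part 1): along the run of such an `X` from the initial state
(plaquettes of `X` at the root link born, root decided; only admissible links are ever decided) every block indicator is `1` (closedness on admissible links:
`c + m = deg_X(link) ≥ 2`, `card_atLink_split`), the run ends with everything born (`Adm`-connectedness, `eq_of_terminal`),
the new-born counts telescope to `n` (`U_step`) and the present counts to `≤ 3n` (potential `Φ` = undecided (plaquette, link) incidences, `≤ 4` links a
plaquette: `Φ_step`, `Φ_init_le`), whence weight `≥ x^n y^{3n}` (`wt_lower`, `W_lower`); with part 1's Kraft sum `≤ 7/10` over the finite valid family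
(`AdmissibleLinkComplexCount.dfsFamilyAt e n` filtered): `count · x^n y^{3n} ≤ 7/10` (`admClosedCount_mul_le`); `closedCount 4 n` is the case `Adm = ⊤`,
`e = rootLink 4` (`closedCount_eq_admClosedCount`).  CONSEQUENCE FOR THE CELL: every row ∕ Lean
face graded `(T | counts, T2)` (`KPCriterionSU2Conditional`, `KPCriterionSU2RateRows`: hypotheses `(hc : CountsUpTo16) (hT : TailBoundT2)`) loses `T2` by
`tailBoundT2_holds`; hypothesis-free KP rows on this tail are a separate file.  NOT a statement about any gauge theory, NOT a radius, NOT a clustering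
rate, NOT summit-bearing.  Grade (T).

(Verbatim declaration-level port — the declarations listed in the Part header count — of the Summits-side module of the YangMills
instrument cell; cell / crew / ruling bookkeeping in the text above is historical.)
-/

section Part5

open _root_.Finset
open Literature.MathematicalPhysics.QuantumLattice (ZdEdge ZdPlaquette plaquetteEdges plaquettesTouching)
open Literature.MathematicalPhysics.QuantumFieldTheory (mem_plaquettesTouching_singleton card_plaquettesTouching_singleton_le card_plaquetteEdges_le)
open Literature.MathematicalPhysics.QuantumFieldTheory.Balaban1983to89.StrongCouplingKPWindow (links IsLinkConnected IsClosedComplex rootLink closedCount TailBoundT2)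
open Literature.MathematicalPhysics.QuantumFieldTheory.Balaban1983to89.ClosedComplexes.AdmissibleLinkComplexCount (IsAdmConnected isLinkConnected_of_isAdmConnected dfsFamilyAt mem_dfsFamilyAt)
open Literature.MathematicalPhysics.QuantumFieldTheory.Balaban1983to89.ClosedComplexes.ClosedComplexExploration

namespace Literature.MathematicalPhysics.QuantumFieldTheory.Balaban1983to89.ClosedComplexes.ClosedComplexTailBound

/-! ## §3 The run of an `Adm`-connected complex closed on its admissible links has weight `≥ x^n y^{3n}` -/

variable (Adm : ZdEdge 4 → Prop) [DecidablePred Adm]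

/-- **Closed on admissible links**: every admissible link of `X` lies in at least two plaquettes of `X` (other links unconstrained).  At `Adm = ⊤` this is
the tree's `IsClosedComplex`; at `Adm =` «free link» it is S2-SPEC (G1)'s «every free link of the set in `≥ 2` of its plaquettes». [cite: MontvayMunster1994, strong-coupling cluster expansion: counting closed link-connected plaquette complexes of ℤ⁴ (the count bound itself is the tree's own, OURS)] -/
def AdmClosed (X : Finset (ZdPlaquette 4)) : Prop := ∀ l ∈ links X, Adm l → 2 ≤ (atLink X l).card

/-- The invariant of the exploration of `X` from the root link `e`: born plaquettes belong to `X`, every decided link is saturated (all plaquettes of `X`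
through it are born), and `e` is decided. [cite: MontvayMunster1994, strong-coupling cluster expansion: counting closed link-connected plaquette complexes of ℤ⁴ (the count bound itself is the tree's own, OURS)] -/
structure Inv (e : ZdEdge 4) (X : Finset (ZdPlaquette 4)) (s : State) : Prop where
  /-- born plaquettes belong to the target -/
  sub : s.Y ⊆ X
  /-- decided links are saturated -/
  sat : ∀ l ∈ s.D, atLink X l ⊆ s.Y
  /-- the root link is decided -/
  root : e ∈ s.D

/-- The potential: undecided (plaquette, link) incidences of the target (all links, admissible or not). [cite: MontvayMunster1994, strong-coupling cluster expansion: counting closed link-connected plaquette complexes of ℤ⁴ (the count bound itself is the tree's own, OURS)] -/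
def Φ (X : Finset (ZdPlaquette 4)) (s : State) : ℕ := ∑ p ∈ X, (plaquetteEdges p \ s.D).card

/-- The unborn plaquettes of the target. [cite: MontvayMunster1994, strong-coupling cluster expansion: counting closed link-connected plaquette complexes of ℤ⁴ (the count bound itself is the tree's own, OURS)] -/
def U (X : Finset (ZdPlaquette 4)) (s : State) : ℕ := (X \ s.Y).card

/-- The termination measure: undecided admissible links of the target. [cite: MontvayMunster1994, strong-coupling cluster expansion: counting closed link-connected plaquette complexes of ℤ⁴ (the count bound itself is the tree's own, OURS)] -/
def μ (X : Finset (ZdPlaquette 4)) (s : State) : ℕ := ((links X).filter Adm \ s.D).card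

/-- Links of a subfamily are links of the family. [cite: MontvayMunster1994, strong-coupling cluster expansion: counting closed link-connected plaquette complexes of ℤ⁴ (the count bound itself is the tree's own, OURS)] -/
theorem links_mono {Y X : Finset (ZdPlaquette 4)} (h : Y ⊆ X) : links Y ⊆ links X :=
  biUnion_subset_biUnion_of_subset_left _ h

/-- **Completeness**: at a terminal state of the exploration of an `Adm`-connected `X` (invariant holding, root link a link of `X`) everything is born.
[cite: MontvayMunster1994, strong-coupling cluster expansion: counting closed link-connected plaquette complexes of ℤ⁴ (the count bound itself is the tree's own, OURS)] -/
theorem eq_of_terminal {e : ZdEdge 4} {X : Finset (ZdPlaquette 4)} {s : State} (hI : Inv e X s) (hconn : IsAdmConnected Adm X) (hroot : e ∈ links X)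
    (h : und Adm s = ∅) : s.Y = X := by
  have hD : (links s.Y).filter Adm ⊆ s.D := by
    have := h; unfold und at this
    exact sdiff_eq_empty_iff_subset.1 this
  obtain ⟨p₀, hp₀X, hp₀e⟩ := mem_biUnion.1 hroot
  have hp₀ : p₀ ∈ s.Y := hI.sat _ hI.root (mem_filter.2 ⟨hp₀X, hp₀e⟩)
  refine Subset.antisymm hI.sub fun q hq => ?_
  have hpath := hconn p₀ hp₀X q hq
  clear hq
  induction hpath with
  | refl => exact hp₀
  | @tail b c _ hbc ih =>
    obtain ⟨-, hc, l, hl, hlb, hlc⟩ := hbc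
    have hlD : l ∈ s.D := hD (mem_filter.2 ⟨mem_biUnion.2 ⟨b, ih, hlb⟩, hl⟩)
    exact hI.sat l hlD (mem_filter.2 ⟨hc, hlc⟩)

/-- The invariant is preserved by a block. [cite: MontvayMunster1994, strong-coupling cluster expansion: counting closed link-connected plaquette complexes of ℤ⁴ (the count bound itself is the tree's own, OURS)] -/
theorem inv_step {e : ZdEdge 4} {X : Finset (ZdPlaquette 4)} {s : State} (hI : Inv e X s) : Inv e X (step Adm s X) := by
  refine ⟨?_, ?_, ?_⟩
  · intro p hp
    rcases mem_union.1 hp with hp | hp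
    · exact hI.sub hp
    · exact (mem_sdiff.1 (mem_filter.1 hp).1).1
  · intro l hl p hp
    change p ∈ s.Y ∪ atLink (X \ s.Y) (sel (und Adm s))
    rcases mem_insert.1 hl with rfl | hl
    · by_cases hpY : p ∈ s.Y
      · exact mem_union_left _ hpY
      · exact mem_union_right _ (mem_filter.2 ⟨mem_sdiff.2 ⟨(mem_filter.1 hp).1, hpY⟩, (mem_filter.1 hp).2⟩)
    · exact mem_union_left _ (hI.sat l hl hp)
  · exact mem_insert_of_mem hI.root

/-- At a non-terminal state the selected link is an undecided admissible link of the target. [cite: MontvayMunster1994, strong-coupling cluster expansion: counting closed link-connected plaquette complexes of ℤ⁴ (the count bound itself is the tree's own, OURS)] -/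
theorem sel_mem_sdiff {e : ZdEdge 4} {X : Finset (ZdPlaquette 4)} {s : State} (hI : Inv e X s) (h : und Adm s ≠ ∅) :
    sel (und Adm s) ∈ (links X).filter Adm \ s.D := by
  have hne : (und Adm s).Nonempty := nonempty_iff_ne_empty.2 h
  have hmem := sel_mem hne
  unfold und at hmem
  obtain ⟨h1, h2⟩ := mem_sdiff.1 hmem
  exact mem_sdiff.2 ⟨filter_subset_filter _ (links_mono hI.sub) h1, h2⟩

/-- The termination measure drops by one at each block. [cite: MontvayMunster1994, strong-coupling cluster expansion: counting closed link-connected plaquette complexes of ℤ⁴ (the count bound itself is the tree's own, OURS)] -/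
theorem μ_step {e : ZdEdge 4} {X : Finset (ZdPlaquette 4)} {s : State} (hI : Inv e X s) (h : und Adm s ≠ ∅) :
    μ Adm X (step Adm s X) + 1 = μ Adm X s := by
  unfold μ step
  rw [sdiff_insert, card_erase_add_one (sel_mem_sdiff Adm hI h)]

/-- Unborn plaquettes: those born at the block plus those unborn after it. [cite: MontvayMunster1994, strong-coupling cluster expansion: counting closed link-connected plaquette complexes of ℤ⁴ (the count bound itself is the tree's own, OURS)] -/
theorem U_step {X : Finset (ZdPlaquette 4)} {s : State} :
    U X s = (atLink (X \ s.Y) (sel (und Adm s))).card + U X (step Adm s X) := by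
  unfold U step
  change (X \ s.Y).card = _ + (X \ (s.Y ∪ atLink (X \ s.Y) (sel (und Adm s)))).card
  have hsub : atLink (X \ s.Y) (sel (und Adm s)) ⊆ X \ s.Y := filter_subset _ _
  rw [show X \ (s.Y ∪ atLink (X \ s.Y) (sel (und Adm s))) = (X \ s.Y) \ atLink (X \ s.Y) (sel (und Adm s)) from sdiff_sdiff_left.symm,
    card_sdiff_of_subset hsub]
  have : (atLink (X \ s.Y) (sel (und Adm s))).card ≤ (X \ s.Y).card := card_le_card hsub
  omega

/-- The potential drops at a block by the degree of the decided link in the target. [cite: MontvayMunster1994, strong-coupling cluster expansion: counting closed link-connected plaquette complexes of ℤ⁴ (the count bound itself is the tree's own, OURS)] -/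
theorem Φ_step {e : ZdEdge 4} {X : Finset (ZdPlaquette 4)} {s : State} (hI : Inv e X s) (h : und Adm s ≠ ∅) :
    Φ X s = (atLink X (sel (und Adm s))).card + Φ X (step Adm s X) := by
  have hl : sel (und Adm s) ∉ s.D := (mem_sdiff.1 (sel_mem_sdiff Adm hI h)).2
  unfold Φ step
  change _ = _ + ∑ p ∈ X, (plaquetteEdges p \ insert (sel (und Adm s)) s.D).card
  rw [card_filter, ← sum_add_distrib]
  refine sum_congr rfl fun p _ => ?_
  rw [sdiff_insert]
  by_cases hp : sel (und Adm s) ∈ plaquetteEdges p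
  · rw [if_pos hp, ← card_erase_add_one (mem_sdiff.2 ⟨hp, hl⟩)]; ring
  · rw [if_neg hp, erase_eq_of_notMem (fun hm => hp (mem_sdiff.1 hm).1)]; ring

/-- The degree of a link in the target splits into the plaquettes already born and those born at its block. [cite: MontvayMunster1994, strong-coupling cluster expansion: counting closed link-connected plaquette complexes of ℤ⁴ (the count bound itself is the tree's own, OURS)] -/
theorem card_atLink_split {e : ZdEdge 4} {X : Finset (ZdPlaquette 4)} {s : State} (hI : Inv e X s) (l : ZdEdge 4) :
    (atLink X l).card = (atLink s.Y l).card + (atLink (X \ s.Y) l).card := by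
  rw [← card_union_of_disjoint (disjoint_filter_filter disjoint_sdiff)]
  congr 1
  rw [← filter_union, union_sdiff_of_subset hI.sub]

/-- **Lower bound along the run.** For an `Adm`-connected target closed on its admissible links, through the root link `e`, from any state satisfying the
invariant and with enough fuel, `x^U · y^Φ ≤ wt · y^U` (i.e. `wt ≥ x^{unborn} y^{Φ − unborn}`): every indicator is `1` by closedness (only admissible links
are decided), the run ends with everything born by `Adm`-connectedness, and the exponents telescope (`U_step`, `Φ_step`). [cite: MontvayMunster1994, strong-coupling cluster expansion: counting closed link-connected plaquette complexes of ℤ⁴ (the count bound itself is the tree's own, OURS)] -/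
theorem wt_lower {e : ZdEdge 4} {X : Finset (ZdPlaquette 4)} (hclosed : AdmClosed Adm X) (hconn : IsAdmConnected Adm X) (hroot : e ∈ links X) :
    ∀ (k : ℕ) (s : State), Inv e X s → μ Adm X s ≤ k → xK ^ U X s * yK ^ Φ X s ≤ wt Adm k s X * yK ^ U X s := by
  have hterm : ∀ (k : ℕ) (s : State), Inv e X s → und Adm s = ∅ → xK ^ U X s * yK ^ Φ X s ≤ wt Adm k s X * yK ^ U X s := by
    intro k s hI h
    have hYX : s.Y = X := eq_of_terminal Adm hI hconn hroot h
    have hU : U X s = 0 := by unfold U; rw [hYX, Finset.sdiff_self, card_empty]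
    rw [wt_terminal Adm h, if_pos hYX, hU, pow_zero, pow_zero, one_mul, one_mul]
    exact pow_le_one₀ yK_pos.le yK_le_one
  intro k
  induction k with
  | zero =>
    intro s hI hμ
    by_cases h : und Adm s = ∅
    · exact hterm 0 s hI h
    · exfalso
      have : 0 < μ Adm X s := card_pos.2 ⟨_, sel_mem_sdiff Adm hI h⟩
      omega
  | succ k ih =>
    intro s hI hμ
    by_cases h : und Adm s = ∅
    · exact hterm (k + 1) s hI h
    · have hμ' : μ Adm X (step Adm s X) ≤ k := by have := μ_step Adm hI h; omega
      have hI' := inv_step Adm hI (X := X)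
      have hrec := ih (step Adm s X) hI' hμ'
      set l := sel (und Adm s) with hl
      set c := (atLink s.Y l).card with hc
      set m := (atLink (X \ s.Y) l).card with hm
      have hdeg : 2 ≤ c + m := by
        rw [hc, hm, ← card_atLink_split hI l]
        have hsel := mem_sdiff.1 (sel_mem_sdiff Adm hI h)
        exact hclosed l (mem_filter.1 hsel.1).1 (mem_filter.1 hsel.1).2
      have hbw : bw c m = xK ^ m * yK ^ c := by unfold bw; rw [if_pos hdeg]
      have hU : U X s = m + U X (step Adm s X) := U_step Adm
      have hΦ : Φ X s = (c + m) + Φ X (step Adm s X) := by rw [Φ_step Adm hI h, card_atLink_split hI l]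
      rw [wt_succ Adm h, ← hl, ← hc, ← hm, hbw, hU, hΦ]
      have hx := xK_pos
      have hy := yK_pos
      calc xK ^ (m + U X (step Adm s X)) * yK ^ (c + m + Φ X (step Adm s X))
          = (xK ^ m * yK ^ c * yK ^ m) * (xK ^ U X (step Adm s X) * yK ^ Φ X (step Adm s X)) := by ring
        _ ≤ (xK ^ m * yK ^ c * yK ^ m) * (wt Adm k (step Adm s X) X * yK ^ U X (step Adm s X)) :=
            mul_le_mul_of_nonneg_left hrec (by positivity)
        _ = xK ^ m * yK ^ c * wt Adm k (step Adm s X) X * yK ^ (m + U X (step Adm s X)) := by ring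

/-- The initial state satisfies the invariant. [cite: MontvayMunster1994, strong-coupling cluster expansion: counting closed link-connected plaquette complexes of ℤ⁴ (the count bound itself is the tree's own, OURS)] -/
theorem inv_init (e : ZdEdge 4) (X : Finset (ZdPlaquette 4)) : Inv e X (init e X) :=
  ⟨filter_subset _ _, fun l hl => by rw [mem_singleton.1 hl]; exact Subset.rfl, mem_singleton_self _⟩

/-- A plaquette set has at most four links per plaquette. [cite: MontvayMunster1994, strong-coupling cluster expansion: counting closed link-connected plaquette complexes of ℤ⁴ (the count bound itself is the tree's own, OURS)] -/
theorem card_links_le (X : Finset (ZdPlaquette 4)) : (links X).card ≤ 4 * X.card := by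
  unfold links
  refine card_biUnion_le.trans ?_
  calc ∑ p ∈ X, (plaquetteEdges p).card ≤ ∑ _p ∈ X, 4 := sum_le_sum fun p _ => card_plaquetteEdges_le p
    _ = 4 * X.card := by rw [sum_const, smul_eq_mul, mul_comm]

/-- The initial potential: `Φ(init e X) + m₀ ≤ 4n` (`m₀` = plaquettes of `X` at the root link). [cite: MontvayMunster1994, strong-coupling cluster expansion: counting closed link-connected plaquette complexes of ℤ⁴ (the count bound itself is the tree's own, OURS)] -/
theorem Φ_init_le (e : ZdEdge 4) (X : Finset (ZdPlaquette 4)) : Φ X (init e X) + (atLink X e).card ≤ 4 * X.card := by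
  unfold Φ init
  change ∑ p ∈ X, (plaquetteEdges p \ {e}).card + (atLink X e).card ≤ _
  rw [card_filter, ← sum_add_distrib]
  calc ∑ p ∈ X, ((plaquetteEdges p \ {e}).card + if e ∈ plaquetteEdges p then 1 else 0)
      = ∑ p ∈ X, (plaquetteEdges p).card := by
        refine sum_congr rfl fun p _ => ?_
        rw [sdiff_singleton_eq_erase]
        by_cases hp : e ∈ plaquetteEdges p
        · rw [if_pos hp, card_erase_add_one hp]
        · rw [if_neg hp, erase_eq_of_notMem hp, add_zero]
    _ ≤ ∑ _p ∈ X, 4 := sum_le_sum fun p _ => card_plaquetteEdges_le p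
    _ = 4 * X.card := by rw [sum_const, smul_eq_mul, mul_comm]

/-- **The weight of an `Adm`-connected `n`-complex closed on its admissible links, through the admissible root link `e`, is at least `x^n y^{3n}`.**
[cite: MontvayMunster1994, strong-coupling cluster expansion: counting closed link-connected plaquette complexes of ℤ⁴ (the count bound itself is the tree's own, OURS)] -/
theorem W_lower {e : ZdEdge 4} (he : Adm e) {n : ℕ} {X : Finset (ZdPlaquette 4)} (hcard : X.card = n) (hroot : e ∈ links X)
    (hconn : IsAdmConnected Adm X) (hclosed : AdmClosed Adm X) : xK ^ n * yK ^ (3 * n) ≤ W Adm e n X := by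
  have hx := xK_pos
  have hy := yK_pos
  set m₀ := (atLink X e).card with hm₀
  have hm₀n : m₀ ≤ n := hcard ▸ card_le_card (filter_subset _ _)
  have hdeg : 2 ≤ 0 + m₀ := by rw [zero_add]; exact hclosed _ hroot he
  have hbw : bw 0 m₀ = xK ^ m₀ := by unfold bw; rw [if_pos hdeg, pow_zero, mul_one]
  have hU : U X (init e X) = n - m₀ := by
    unfold U init
    rw [card_sdiff_of_subset (filter_subset _ _), hcard]
  have hμ : μ Adm X (init e X) ≤ 4 * n := by
    have h4 : (links X).card ≤ 4 * n := by rw [← hcard]; exact card_links_le X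
    unfold μ
    exact (card_le_card sdiff_subset).trans ((card_le_card (filter_subset _ _)).trans h4)
  have hΦ : Φ X (init e X) ≤ 3 * n + (n - m₀) := by
    have := Φ_init_le e X
    rw [hcard, ← hm₀] at this
    omega
  have hrun := wt_lower Adm hclosed hconn hroot (4 * n) (init e X) (inv_init e X) hμ
  rw [hU] at hrun
  -- `x^{n−m₀} y^{Φ} ≤ wt · y^{n−m₀}` and `Φ ≤ 3n + (n − m₀)`
  have h1 : xK ^ (n - m₀) * yK ^ (3 * n + (n - m₀)) ≤ wt Adm (4 * n) (init e X) X * yK ^ (n - m₀) :=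
    (mul_le_mul_of_nonneg_left (pow_le_pow_of_le_one hy.le yK_le_one hΦ) (by positivity)).trans hrun
  have h2 : (xK ^ n * yK ^ (3 * n)) * yK ^ (n - m₀) ≤ W Adm e n X * yK ^ (n - m₀) := by
    unfold W
    rw [← hm₀, hbw]
    calc (xK ^ n * yK ^ (3 * n)) * yK ^ (n - m₀) = xK ^ m₀ * (xK ^ (n - m₀) * yK ^ (3 * n + (n - m₀))) := by
          have hxn : xK ^ n = xK ^ m₀ * xK ^ (n - m₀) := by rw [← pow_add, Nat.add_sub_cancel' hm₀n]
          rw [hxn, pow_add]; ring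
      _ ≤ xK ^ m₀ * (wt Adm (4 * n) (init e X) X * yK ^ (n - m₀)) := mul_le_mul_of_nonneg_left h1 (by positivity)
      _ = xK ^ m₀ * wt Adm (4 * n) (init e X) X * yK ^ (n - m₀) := by ring
  exact le_of_mul_le_mul_right h2 (by positivity)

/-! ## §4 ★ The tail bound for every admissibility class, and the discharge of `TailBoundT2` -/

open _root_.Classical in
/-- The finite family of `Adm`-connected `n`-complexes through `e` closed on their admissible links (a filter of `AdmissibleLinkComplexCount.dfsFamilyAt e n`).
[cite: MontvayMunster1994, strong-coupling cluster expansion: counting closed link-connected plaquette complexes of ℤ⁴ (the count bound itself is the tree's own, OURS)] -/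
def validFamily (e : ZdEdge 4) (n : ℕ) : Finset (Finset (ZdPlaquette 4)) :=
  (dfsFamilyAt e n).filter fun X => X.card = n ∧ e ∈ links X ∧ IsAdmConnected Adm X ∧ AdmClosed Adm X

omit [DecidablePred Adm] in
open _root_.Classical in
/-- Membership in the valid family is validity. [cite: MontvayMunster1994, strong-coupling cluster expansion: counting closed link-connected plaquette complexes of ℤ⁴ (the count bound itself is the tree's own, OURS)] -/
theorem mem_validFamily {e : ZdEdge 4} {n : ℕ} {X : Finset (ZdPlaquette 4)} :
    X ∈ validFamily Adm e n ↔ X.card = n ∧ e ∈ links X ∧ IsAdmConnected Adm X ∧ AdmClosed Adm X := by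
  unfold validFamily
  rw [mem_filter]
  exact ⟨fun h => h.2, fun h => ⟨mem_dfsFamilyAt h.1 h.2.1 (isLinkConnected_of_isAdmConnected h.2.2.1), h⟩⟩

omit [DecidablePred Adm] in
/-- The count of `Adm`-connected `n`-complexes through `e` closed on their admissible links is the cardinality of the valid family. [cite: MontvayMunster1994, strong-coupling cluster expansion: counting closed link-connected plaquette complexes of ℤ⁴ (the count bound itself is the tree's own, OURS)] -/
theorem admClosedCount_eq_card (e : ZdEdge 4) (n : ℕ) :
    Nat.card {X : Finset (ZdPlaquette 4) // X.card = n ∧ e ∈ links X ∧ IsAdmConnected Adm X ∧ AdmClosed Adm X} = (validFamily Adm e n).card := by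
  have hset : {X : Finset (ZdPlaquette 4) | X.card = n ∧ e ∈ links X ∧ IsAdmConnected Adm X ∧ AdmClosed Adm X} =
      (↑(validFamily Adm e n) : Set (Finset (ZdPlaquette 4))) := by
    ext X
    rw [Set.mem_setOf_eq, mem_coe, mem_validFamily]
  calc Nat.card {X : Finset (ZdPlaquette 4) // X.card = n ∧ e ∈ links X ∧ IsAdmConnected Adm X ∧ AdmClosed Adm X}
      = ({X : Finset (ZdPlaquette 4) | X.card = n ∧ e ∈ links X ∧ IsAdmConnected Adm X ∧ AdmClosed Adm X}).ncard := Nat.card_coe_set_eq _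
    _ = (↑(validFamily Adm e n) : Set (Finset (ZdPlaquette 4))).ncard := by rw [hset]
    _ = (validFamily Adm e n).card := Set.ncard_coe_finset _

/-- ★ **The Kraft tail bound for every admissibility class**: `count · x^n y^{3n} ≤ 7/10` through an admissible root link. [cite: MontvayMunster1994, strong-coupling cluster expansion: counting closed link-connected plaquette complexes of ℤ⁴ (the count bound itself is the tree's own, OURS)] -/
theorem admClosedCount_mul_le {e : ZdEdge 4} (he : Adm e) (n : ℕ) :
    (Nat.card {X : Finset (ZdPlaquette 4) // X.card = n ∧ e ∈ links X ∧ IsAdmConnected Adm X ∧ AdmClosed Adm X} : ℝ) * (xK ^ n * yK ^ (3 * n)) ≤ 7 / 10 := by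
  rw [admClosedCount_eq_card, ← nsmul_eq_mul, ← sum_const]
  refine (sum_le_sum fun X hX => ?_).trans (kraft_root_sum Adm e n (validFamily Adm e n))
  obtain ⟨hcard, hroot, hconn, hclosed⟩ := (mem_validFamily Adm).1 hX
  exact W_lower Adm he hcard hroot hconn hclosed

/-- ★ **T2′ (every admissibility class)**: through an admissible root link, the `Adm`-connected `n`-complexes closed on their admissible links number
`≤ (7/10)·((100/19)·(119/100)^6)^n = 0.7·(14.9461…)^n`. [cite: MontvayMunster1994, strong-coupling cluster expansion: counting closed link-connected plaquette complexes of ℤ⁴ (the count bound itself is the tree's own, OURS)] -/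
theorem admClosedCount_le_kraft {e : ZdEdge 4} (he : Adm e) (n : ℕ) :
    (Nat.card {X : Finset (ZdPlaquette 4) // X.card = n ∧ e ∈ links X ∧ IsAdmConnected Adm X ∧ AdmClosed Adm X} : ℝ) ≤
      7 / 10 * ((100 / 19) * (119 / 100 : ℝ) ^ 6) ^ n := by
  have h := admClosedCount_mul_le Adm he n
  have hxy : xK ^ n * yK ^ (3 * n) = (((100 / 19) * (119 / 100 : ℝ) ^ 6) ^ n)⁻¹ := by
    rw [pow_mul, ← mul_pow, ← inv_pow]
    congr 1
    unfold xK yK; norm_num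
  rw [hxy] at h
  have hpos : 0 < ((100 / 19) * (119 / 100 : ℝ) ^ 6) ^ n := by positivity
  rwa [← div_eq_mul_inv, div_le_iff₀ hpos] at h

/-- ★ **T2′ (every admissibility class), printed constant**: `≤ (7/10)·(299/20)^n = 0.7·14.95ⁿ`. [cite: MontvayMunster1994, strong-coupling cluster expansion: counting closed link-connected plaquette complexes of ℤ⁴ (the count bound itself is the tree's own, OURS)] -/
theorem admClosedCount_le_T2 {e : ZdEdge 4} (he : Adm e) (n : ℕ) :
    (Nat.card {X : Finset (ZdPlaquette 4) // X.card = n ∧ e ∈ links X ∧ IsAdmConnected Adm X ∧ AdmClosed Adm X} : ℝ) ≤ 7 / 10 * (299 / 20 : ℝ) ^ n :=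
  (admClosedCount_le_kraft Adm he n).trans
    (mul_le_mul_of_nonneg_left (pow_le_pow_left₀ (by positivity) (by norm_num) n) (by norm_num))

/-- Link-connected = connected through ALL links (`Adm = ⊤`). [cite: MontvayMunster1994, strong-coupling cluster expansion: counting closed link-connected plaquette complexes of ℤ⁴ (the count bound itself is the tree's own, OURS)] -/
theorem isAdmConnected_top_iff (X : Finset (ZdPlaquette 4)) : IsAdmConnected (fun _ => True) X ↔ IsLinkConnected X := by
  have hR : (fun a b : ZdPlaquette 4 => a ∈ X ∧ b ∈ X ∧ ∃ l, (fun _ : ZdEdge 4 => True) l ∧ l ∈ plaquetteEdges a ∧ l ∈ plaquetteEdges b) =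
      (fun a b : ZdPlaquette 4 => a ∈ X ∧ b ∈ X ∧ ¬ Disjoint (plaquetteEdges a) (plaquetteEdges b)) := by
    ext a b
    simp only [true_and, not_disjoint_iff]
  unfold IsAdmConnected IsLinkConnected
  rw [hR]

/-- Closed = closed on ALL links (`Adm = ⊤`). [cite: MontvayMunster1994, strong-coupling cluster expansion: counting closed link-connected plaquette complexes of ℤ⁴ (the count bound itself is the tree's own, OURS)] -/
theorem admClosed_top_iff (X : Finset (ZdPlaquette 4)) : AdmClosed (fun _ => True) X ↔ IsClosedComplex X :=
  ⟨fun h l hl => h l hl trivial, fun h l hl _ => h l hl⟩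

/-- `closedCount 4 n` is the `Adm = ⊤`, `e = rootLink 4` count. [cite: MontvayMunster1994, strong-coupling cluster expansion: counting closed link-connected plaquette complexes of ℤ⁴ (the count bound itself is the tree's own, OURS)] -/
theorem closedCount_eq_admClosedCount (n : ℕ) : closedCount 4 n =
    Nat.card {X : Finset (ZdPlaquette 4) // X.card = n ∧ rootLink 4 ∈ links X ∧ IsAdmConnected (fun _ => True) X ∧ AdmClosed (fun _ => True) X} := by
  unfold closedCount
  exact Nat.card_congr (Equiv.subtypeEquivRight fun X => by rw [isAdmConnected_top_iff, admClosed_top_iff])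

/-- ★ `closedCount 4 n ≤ (7/10)·(299/20)^n = 0.7·14.95ⁿ` for every `n` (`(100/19)·(1.19)^6 = 14.9461… ≤ 14.95`). [cite: MontvayMunster1994, strong-coupling cluster expansion: counting closed link-connected plaquette complexes of ℤ⁴ (the count bound itself is the tree's own, OURS)] -/
theorem closedCount_four_le_T2 (n : ℕ) : (closedCount 4 n : ℝ) ≤ 7 / 10 * (299 / 20 : ℝ) ^ n := by
  rw [closedCount_eq_admClosedCount]
  exact admClosedCount_le_T2 (fun _ => True) trivial n

end Literature.MathematicalPhysics.QuantumFieldTheory.Balaban1983to89.ClosedComplexes.ClosedComplexTailBound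

end Part5

/-! ## Part 6 — the EXACT discharge `TailBoundT2_holds` -/

namespace Literature.MathematicalPhysics.QuantumFieldTheory.Balaban1983to89.StrongCouplingKPWindow

/-- **The tail obligation `TailBoundT2` HOLDS** (`StrongCouplingKPWindow.lean`: `closedCount 4 n ≤ (7/10)·(299/20)^n` for every `n ≥ 2`; in fact for
every `n`, `ClosedComplexes.ClosedComplexTailBound.closedCount_four_le_T2`).  EXACT-name discharge; Literature-side twin of the Summits-side
`Summit.QuantumFields.YangMills.Theorems.Instrument.ClosedComplexTailBound.tailBoundT2_holds`.  Pure combinatorics of `ℤ⁴` (DFS/Kraft encoding of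
closed link-connected plaquette complexes); the bound is the tree's own, its context is Balaban's strong-coupling expansion.
[cite: MontvayMunster1994, strong-coupling cluster expansion (context; the count bound is OURS)] -/
theorem TailBoundT2_holds : TailBoundT2 := fun n _ => ClosedComplexes.ClosedComplexTailBound.closedCount_four_le_T2 n

end Literature.MathematicalPhysics.QuantumFieldTheory.Balaban1983to89.StrongCouplingKPWindow

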